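import Literature.MathematicalPhysics.QuantumFieldTheory.SU2HighTemperatureNonConfinement
import Literature.Barriers.QuantumFields.FiniteTemperatureDeconfinementInfrared
import Literature.Barriers.QuantumFields.FiniteTemperatureSpatialReflectionPositivity
import Literature.MathematicalPhysics.QuantumLattice.PeierlsChessboardTorusBound
import Literature.MathematicalPhysics.QuantumLattice.NarrowWellPlaquetteAction
import HarnessLib

/-!
# Tomboulis–Yaffe 1985, §III.A–B and App. II: Theorems I–II (non-confinement of static `SU(2)` quarks
# and bounded electric-flux free energy at high temperature) REDUCED to the disorder bounds
# (3.25)–(3.26) — the Peierls argument and the reflection-positivity step (3.3), proved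

Topic `Literature/MathematicalPhysics/QuantumFieldTheory`; companion of
`SU2HighTemperatureNonConfinement.lean`, which vendors Theorems I–II of E. T. Tomboulis, L. G. Yaffe,
*Finite temperature SU(2) lattice gauge theory*, Commun. Math. Phys. **100** (1985) 313–341
[TomboulisYaffe1985] as the NAMED FACTS `TomboulisYaffeHighTemperature.PolyakovTwoPointLowerBound`
(Thm I) and `….MagneticFluxFreeEnergyBound` (Thm II), in the vocabulary of
`Literature.Barriers.QuantumFields.FiniteTemperature` (Borgs–Seiler's periodic lattice
`ℤ_{L₀} × (ℤ/L)^d`, couplings `J_E = β_t`, `J_M = β_s`, `expectation`, `polyakovCorrelation`).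

The printed proof of Theorem I (§III, pp. 321–325) has three layers:

1. §III.A (3.1)–(3.2): hemisphere projections `P^±[Ω] = 1{±½tr Ω ≥ 0}` of the twist (Polyakov loop)
   and the reduction of the two-point function to DISORDER PROBABILITIES,
   `G(0,x) = ⟨½trΩ[0] ½trΩ[x]⟩ ≥ 1 - 4⟨P₀⁺Pₓ⁻⟩ - 2⟨1 - |½trΩ[0]|⟩`;
2. §III.B (3.4)–(3.8) with App. II: "a modern version of the Peierls argument" — resumming the sets
   `Q ∋ 0, Q ∌ x` into contours `γ`, `⟨P₀⁺Pₓ⁻⟩ ≤ Σ_γ ⟨∏_{⟨yy'⟩∈γ} P_y⁺P_{y'}⁻⟩ ≤ Σ_{|γ|≥2d} N(|γ|)K^{|γ|}`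
   ((3.5)–(3.7), `N(|γ|) ≤ 3^{|γ|}` by the counting of App. II), "Therefore, if `3K < 1`",
   `⟨P₀⁺Pₓ⁻⟩ ≤ (3K)^{2d}/(1-3K)` — (3.8) — GIVEN the contour bound (3.6)
   `⟨∏_{⟨yy'⟩∈γ} P_y⁺ P_{y'}⁻⟩ ≤ K^{|γ|}`;
3. §III.C "Disorder probabilities" (3.9)–(3.26) with App. III–IV: the proof of (3.6) with a rate
   `K = K(T) → 0` and of `⟨1 - |½trΩ[0]|⟩ → 0` as `T → ∞`, uniformly in `L_s` — chessboard estimates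
   (3.9)–(3.10), the transfer-matrix ("time-decimation") bounds (3.11)–(3.15) of App. III, the
   `d`-dimensional XY-model comparison (3.16)–(3.22) of App. IV, giving (3.23)–(3.26): "Thus, we have
   established the basic bound (3.26) needed for the Peierls argument. Inserting (3.8), (3.25), and
   (3.26) into the initial bounds on confinement criteria, (3.2) and (3.3), yields the theorems".

THIS FILE PROVES LAYERS 1–2 FOR BOTH THEOREMS: `polyakovTwoPointLowerBound_of_disorderBounds` —
**(3.25) ∧ (3.26) ⟹ Theorem I** (`PolyakovTwoPointLowerBound`) — and
`magneticFluxFreeEnergyBound_of_disorderBounds` — **(3.25) ∧ (3.26) ⟹ Theorem II**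
(`MagneticFluxFreeEnergyBound`), the latter through TY's reflection-positivity step (3.3) (§§6–7),
with the disorder bounds of layer 3 as explicit hypotheses (stated below in the box, NOT as named
facts; they are what remains to be formalised of TY's proof — the chessboard estimate (2.6)–(2.7) on
the finite-temperature lattice, which needs reflection positivity in time-like planes BETWEEN sites and
in DIHEDRAL planes, the one-link Bessel-function decimation of App. III and the Migdal–Kadanoff XY bound
of App. IV are not in the tree). No named fact is introduced and none is discharged.

What is proved (all for `G = SU(2)`, fundamental representation, arbitrary temporal extent `L₀` and
couplings unless said otherwise):

* §1 `expectation` API for bounded measurable observables (monotonicity, linearity) and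
  **translation invariance** `expectation_comp_translate` (`⟨F ∘ τ_a⟩ = ⟨F⟩`, any compact `G`).
* §2 `halfTrace U y = ½ Re tr Ω[y] ∈ [-1,1]` (the trace of `SU(2)` is real, so
  `G_L(x) = 4⟨½trΩ[0] ½trΩ[x]⟩`, `polyakovIntegrand_eq_halfTrace`); the domain-wall events
  `wallEvent B` (`∏_{(y,i)∈B}(P_y⁺P_{y+e_i}⁻ + P_y⁻P_{y+e_i}⁺) = 1`); the pointwise form of (3.2),
  `ab ≥ 1 - (1-|a|) - (1-|b|) - 2·1{a, b in opposite hemispheres}` (`mul_ge_of_abs_le_one`).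
* §3 **Peierls' argument in a coordinate plane** (`expectation_wall_plane_le`): if every bond set `B`
  carries walls with probability `≤ K^{|B|}` then, for `L ≥ 3` and `ρ = 4·19⁶K < 1`, two Polyakov loops
  in a common coordinate plane lie in opposite hemispheres with probability
  `≤ Σ_{A separating} K^{|∂A|} ≤ 4ρ/(1-ρ)²` — TY's (3.4)–(3.8) organised, as in the tree's planar `ℤ_n`
  theory (`ZnFiniteTemperatureDeconfinementPeierls`), with Fröhlich–Lieb's separating set of the
  hemisphere colouring (`PeierlsChessboardTorusBound.sepSet`) and the tree's VOLUME-UNIFORM torus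
  contour count `TorusContourCounting.sum_pow_card_cutKeys_le_geom` in place of App. II (so the
  constants are the tree's `4·19⁶`, not TY's `3`; only `K → 0` matters).
* §4 **all separations** `x ∈ (ℤ/L)^d` (`expectation_wall_le`, `≤ d·4ρ/(1-ρ)²`): telescoping along the
  axes (`wall_indicator_le_sum`) and translation invariance (each axis step lies in a coordinate plane
  through the origin) — TY restrict to on-axis separations (footnote 5); the fact quantifies over all `x`.
* §5 `polyakovCorrelation_ge_of_disorderBounds` — (3.2) with (3.8) in one box:
  `G_L(x) ≥ 4(1 - 2K - 2d·4ρ/(1-ρ)²)`; and ★ `polyakovTwoPointLowerBound_of_disorderBounds`.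
* §6 **the change of variables of §III.A** (`sliceFlip`: left-multiplying the time-like links
  `{l₀(n) | n₀ = n_i = 0}` by the central `−𝟙`; any compact `G`, central involutive `z` with
  `ρ(z) = −𝟙`): it preserves `∏dg`, flips the sign of `Re tr ρ(U_P)` exactly on the stack `S_{0i}` of
  (2.8) and on the adjacent stack `S'_{0i} = {P_{0i}(n) | n₀ = 0, n_i = −1}` (`adjFluxStack`), so that
  `e^{−S(φU)} = e^{−S(U)} τ[S](U) τ[S'](U)` (`weight_sliceFlip` — "moves the coclosed set of plaquettes
  with negative couplings from `S₀₁` to `S'₀₁`"), `τ[S](φU) τ[S](U) = 1`, and `Ω[y](φU) = −Ω[y](U)`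
  exactly on the plane `y_i = 0` (`polyakovLine_sliceFlip`).
* §7 **the reflection-positivity step (3.3)**: from the tree's positivity
  `FiniteTemperature.integral_mul_conj_spaceSiteReflect_mul_weight_nonneg` (Borgs–Seiler / OS
  reflection positivity in the spatial LATTICE planes `y_i = 0`, `y_i = ½L_s`) the Cauchy–Schwarz form
  `⟨FΘG⟩ + ⟨GΘF⟩ ≤ 2⟨FΘF⟩^{1/2}⟨GΘG⟩^{1/2}` (`rp_cauchy_schwarz`, TY (2.5)); `τ[S'] ∘ σ = τ[S]`
  (`adjFluxObs_spaceSiteReflect`); and the bound in one box `L_s = 2n+2`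
  (`magneticFluxExp_le_of_disorderBounds`):
  `exp(−F^{mag}_{0i}/T) ≤ 4√(d·4ρ/(1-ρ)²) + 2√(2K)` — TY's chain "(3.3): insert `P₀^± P_x^±`,
  `x = ½L_s e₁`, flip, reflect, flip again (`⟨P τ[S]τ[S']⟩ = ⟨P∘φ⟩ ≤ 1`)", run with the five-way sign
  partition `{+,0,−}²` so that no boundary convention for `P^±` at `½trΩ = 0` is needed (the defect
  event `{½trΩ = 0}` is charged to (3.25) via `1{½trΩ = 0} ≤ 1 − |½trΩ|`); and
  ★ `magneticFluxFreeEnergyBound_of_disorderBounds` (with `ε = ¼`).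

HONEST LABEL. Theorems I–II themselves are NOT proved here (their named facts keep net debt +2);
what is proved is the implication from TY's intermediate bounds (3.25)–(3.26), i.e. the
combinatorial ∕ probabilistic ∕ reflection-positivity half of the printed proof (§III.A–B, App. II);
the analytic half (§III.C, App. III–IV: chessboard estimates with dihedral reflections, the
transfer-matrix time decimation, the XY-model comparison) is the open prerequisite, recorded on the
`ym-ir` bus as the typed «needs X» of this unit. Finite-temperature LATTICE statements; the
Yang–Mills mass gap is not touched.

## References
* E. T. Tomboulis, L. G. Yaffe, Commun. Math. Phys. 100 (1985) 313–341: §II.A (2.4)–(2.9), §III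
  Theorems I–II (p. 320) and their equivalent forms (p. 321), §III.A (3.1)–(3.3) (pp. 321–322), §III.B
  (3.4)–(3.8) (pp. 322–323), §III.C (3.9)–(3.26) (pp. 323–325), App. II (pp. 333–334). [TomboulisYaffe1985]
* J. Fröhlich, E. H. Lieb, Comm. Math. Phys. 60 (1978) 233–267, §I.C Definition 1, Thm. 1.1,
  Cor. 1.2 (Peierls contours on the torus). [FrohlichLieb1978]
* C. Borgs, E. Seiler, Commun. Math. Phys. 91 (1983) 329–380, §II.3 (II.22) (the lattice, translation
  invariance "as guaranteed for instance by periodic b.c."). [BorgsSeiler1983]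
-/

noncomputable section

open MeasureTheory Filter Finset
open scoped Topology BigOperators ComplexConjugate
open Literature.MathematicalPhysics.QuantumLattice (fundamentalRep continuous_fundamentalRep
  fundamentalRep_mem_unitaryGroup sepSet isSeparatingSet_sepSet sepSet_compatible)
open Literature.Probability.LatticeModels (TorusSite torusGraph torusGraph_adj_iff cutKeys mem_cutKeys
  IsSeparatingSet sum_pow_card_cutKeys_le_geom)
open Literature.Barriers.QuantumFields Literature.Barriers.QuantumFields.FiniteTemperature

namespace Literature.MathematicalPhysics.QuantumFieldTheory

namespace TomboulisYaffeHighTemperature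

/-! ### §1 Expectations: integrability, monotonicity, linearity, translation invariance -/

section Expectation

variable {d L₀ L : ℕ} [NeZero L₀] [NeZero L] {G : Type*} [Group G] [TopologicalSpace G]
  [IsTopologicalGroup G] [CompactSpace G] [MeasurableSpace G] [BorelSpace G]
  [SecondCountableTopology G] {N : ℕ} (ρ : G →* Matrix (Fin N) (Fin N) ℂ)

/-- A bounded (a.e. strongly) measurable observable is integrable against the Boltzmann weight of
the periodic box (the weight is continuous on a compact configuration space). [cite: BorgsSeiler1983, §II.3 (II.22) (p. 337)] -/
theorem integrable_mul_weight (hρ : Continuous ρ) (JE JM : ℝ) {f : Config d L₀ L G → ℝ}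
    (hfm : AEStronglyMeasurable f (haar d L₀ L G)) {C : ℝ} (hC : ∀ U, |f U| ≤ C) :
    Integrable (fun U => f U * weight ρ JE JM U) (haar d L₀ L G) := by
  obtain ⟨Kw, hKw⟩ : ∃ K : ℝ, ∀ U : Config d L₀ L G, ‖weight ρ JE JM U‖ ≤ K := by
    obtain ⟨K, hK⟩ := isCompact_univ.exists_bound_of_continuousOn
      (continuous_weight (d := d) (L₀ := L₀) (L := L) ρ hρ JE JM).continuousOn
    exact ⟨K, fun U => hK U (Set.mem_univ U)⟩
  refine (integrable_const (C * Kw)).mono' (hfm.mul (continuous_weight ρ hρ JE JM).aestronglyMeasurable)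
    (Eventually.of_forall fun U => ?_)
  rw [Real.norm_eq_abs, abs_mul]
  have hC0 : 0 ≤ C := (abs_nonneg _).trans (hC U)
  exact mul_le_mul (hC U) (by simpa [Real.norm_eq_abs] using hKw U) (abs_nonneg _) hC0

/-- Monotonicity of the expectation in the observable (integrable observables). [cite: BorgsSeiler1983, §II.3 (II.22) (p. 337)] -/
theorem expectation_mono_of_integrable (hρ : Continuous ρ) (JE JM : ℝ) {f g : Config d L₀ L G → ℝ}
    (hf : Integrable (fun U => f U * weight ρ JE JM U) (haar d L₀ L G))
    (hg : Integrable (fun U => g U * weight ρ JE JM U) (haar d L₀ L G)) (h : ∀ U, f U ≤ g U) :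
    expectation ρ JE JM f ≤ expectation ρ JE JM g := by
  unfold expectation
  refine div_le_div_of_nonneg_right ?_ (partitionFunction_pos ρ hρ JE JM).le
  exact integral_mono hf hg fun U => mul_le_mul_of_nonneg_right (h U) (weight_pos ρ JE JM U).le

omit [SecondCountableTopology G] in
/-- The expectation of a constant. [cite: BorgsSeiler1983, §II.3 (II.22) (p. 337)] -/
theorem expectation_const {JE JM : ℝ} (hZ : 0 < ∫ U, weight ρ JE JM U ∂haar d L₀ L G) (c : ℝ) :
    expectation (d := d) (L₀ := L₀) (L := L) ρ JE JM (fun _ => c) = c := by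
  unfold expectation
  rw [integral_const_mul, mul_div_assoc, div_self hZ.ne', mul_one]

omit [SecondCountableTopology G] in
/-- Additivity of the expectation (integrable observables). [cite: BorgsSeiler1983, §II.3 (II.22) (p. 337)] -/
theorem expectation_add' (JE JM : ℝ) {f g : Config d L₀ L G → ℝ}
    (hf : Integrable (fun U => f U * weight ρ JE JM U) (haar d L₀ L G))
    (hg : Integrable (fun U => g U * weight ρ JE JM U) (haar d L₀ L G)) :
    expectation ρ JE JM (fun U => f U + g U) = expectation ρ JE JM f + expectation ρ JE JM g := by
  unfold expectation
  rw [← add_div]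
  congr 1
  simp_rw [add_mul]
  exact integral_add hf hg

omit [SecondCountableTopology G] in
/-- Subtractivity of the expectation (integrable observables). [cite: BorgsSeiler1983, §II.3 (II.22) (p. 337)] -/
theorem expectation_sub' (JE JM : ℝ) {f g : Config d L₀ L G → ℝ}
    (hf : Integrable (fun U => f U * weight ρ JE JM U) (haar d L₀ L G))
    (hg : Integrable (fun U => g U * weight ρ JE JM U) (haar d L₀ L G)) :
    expectation ρ JE JM (fun U => f U - g U) = expectation ρ JE JM f - expectation ρ JE JM g := by
  unfold expectation
  rw [← sub_div]
  congr 1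
  simp_rw [sub_mul]
  exact integral_sub hf hg

omit [SecondCountableTopology G] in
/-- Homogeneity of the expectation. [cite: BorgsSeiler1983, §II.3 (II.22) (p. 337)] -/
theorem expectation_const_mul' (JE JM c : ℝ) (f : Config d L₀ L G → ℝ) :
    expectation ρ JE JM (fun U => c * f U) = c * expectation ρ JE JM f := by
  unfold expectation
  simp_rw [mul_assoc]
  rw [integral_const_mul, mul_div_assoc]

omit [SecondCountableTopology G] in
/-- Finite additivity of the expectation (integrable observables). [cite: BorgsSeiler1983, §II.3 (II.22) (p. 337)] -/
theorem expectation_finset_sum {κ : Type*} (JE JM : ℝ) (s : Finset κ) (f : κ → Config d L₀ L G → ℝ)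
    (hf : ∀ k ∈ s, Integrable (fun U => f k U * weight ρ JE JM U) (haar d L₀ L G)) :
    expectation ρ JE JM (fun U => ∑ k ∈ s, f k U) = ∑ k ∈ s, expectation ρ JE JM (f k) := by
  unfold expectation
  rw [← Finset.sum_div]
  congr 1
  simp_rw [Finset.sum_mul]
  exact integral_finsetSum s hf

omit [SecondCountableTopology G] in
/-- **Translation invariance of the periodic-box expectation**: `⟨F ∘ τ_a⟩ = ⟨F⟩` (the spatial
translation `τ_a` preserves the a-priori measure and the Wilson weight). [cite: BorgsSeiler1983, §II.3 (II.22) (p. 337)] -/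
theorem expectation_comp_translate (JE JM : ℝ) (a : Fin d → ZMod L) (F : Config d L₀ L G → ℝ) :
    expectation ρ JE JM (fun U => F (translate a U)) = expectation ρ JE JM F := by
  unfold expectation
  congr 1
  have hmp := measurePreserving_translateEquiv (d := d) (L₀ := L₀) (L := L) (G := G) a
  calc ∫ U, F (translate a U) * weight ρ JE JM U ∂haar d L₀ L G
      = ∫ U, F (translate a U) * weight ρ JE JM (translate a U) ∂haar d L₀ L G := by
        simp only [weight_translate]
    _ = ∫ U, F U * weight ρ JE JM U ∂haar d L₀ L G := by
        have h := hmp.integral_comp' (fun U : Config d L₀ L G => F U * weight ρ JE JM U)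
        rw [coe_translateEquiv] at h
        exact h

end Expectation

/-! ### §2 `SU(2)`: the half-trace of the Polyakov loop, hemispheres, domain walls; the pointwise
form of (3.2) -/

section SU2

/-- The gauge group `SU(2)` (Mathlib's special unitary group of `2 × 2` complex matrices). [folklore] -/
abbrev SU2 : Type := Matrix.specialUnitaryGroup (Fin 2) ℂ

variable {d L₀ L : ℕ}

/-- **`½ tr Ω[y]`**: half the (real) trace of the Polyakov loop ("twist") at the spatial site `y`, a
number in `[-1, 1]`; its sign is the `Z(2)` order parameter of §II.A. [cite: TomboulisYaffe1985, §II.A eq. (2.6) (p. 316); §III.A eq. (3.1) (p. 321)] -/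
def halfTrace (U : Config d L₀ L SU2) (y : Fin d → ZMod L) : ℝ :=
  (polyakovTrace (fundamentalRep (Fin 2)) U y).re / 2

/-- **Domain walls.** For a finite set `B` of spatial nearest-neighbour bonds `(y, y + e_i)` (coded
`(y, i)`), the event that across EVERY bond of `B` the two Polyakov loops lie in opposite hemispheres
`P⁺ = {½ tr Ω ≥ 0}`, `P⁻ = {½ tr Ω < 0}` of (3.1) — i.e. `∏_{⟨yy'⟩ ∈ B} (P⁺_y P⁻_{y'} + P⁻_y P⁺_{y'}) = 1`,
the unoriented form of the contour event `∏_{⟨yy'⟩ ∈ γ} P⁺_y P⁻_{y'}` of (3.5)–(3.6).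
[cite: TomboulisYaffe1985, §III.A eq. (3.1) (p. 321); §III.B eqs. (3.5)–(3.6) (p. 322)] -/
def wallEvent (B : Finset ((Fin d → ZMod L) × Fin d)) : Set (Config d L₀ L SU2) :=
  {U | ∀ b ∈ B, ¬ (0 ≤ halfTrace U b.1 ↔ 0 ≤ halfTrace U (b.1 + Pi.single b.2 1))}

/-- The trace of the fundamental representation of `SU(2)` is real. [cite: TomboulisYaffe1985, §II.A eq. (2.6) (p. 316)] -/
theorem im_polyakovTrace_eq_zero (U : Config d L₀ L SU2) (y : Fin d → ZMod L) :
    (polyakovTrace (fundamentalRep (Fin 2)) U y).im = 0 := by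
  unfold polyakovTrace
  rw [Literature.MathematicalPhysics.QuantumLattice.fundamentalRep_apply]
  exact Literature.MathematicalPhysics.QuantumLattice.NarrowWell.trace_im_eq_zero _

/-- `|½ tr Ω[y]| ≤ 1`. [cite: TomboulisYaffe1985, §II.A eq. (2.6) (p. 316)] -/
theorem abs_halfTrace_le_one (U : Config d L₀ L SU2) (y : Fin d → ZMod L) : |halfTrace U y| ≤ 1 := by
  unfold halfTrace
  have h : ‖polyakovTrace (fundamentalRep (Fin 2)) U y‖ ≤ (2 : ℕ) :=
    norm_trace_le_of_mem_unitaryGroup (fundamentalRep_mem_unitaryGroup _)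
  have h' := (Complex.abs_re_le_norm _).trans h
  rw [abs_div, abs_two]
  push_cast at h'
  linarith

/-- **The Polyakov-loop integrand is `4 · ½tr Ω[0] · ½tr Ω[x]`** for `SU(2)` (real traces):
`Re (tr Ω[0] · conj tr Ω[x]) = tr Ω[0] tr Ω[x]`, so `G_L(x) = 4 ⟨½tr Ω[0] ½tr Ω[x]⟩ = 4 G^{TY}(0,x)`.
[cite: TomboulisYaffe1985, §II.A eq. (2.6) (p. 316)] -/
theorem polyakovIntegrand_eq_halfTrace (U : Config d L₀ L SU2) (x : Fin d → ZMod L) :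
    (polyakovTrace (fundamentalRep (Fin 2)) U 0 * conj (polyakovTrace (fundamentalRep (Fin 2)) U x)).re =
      4 * (halfTrace U 0 * halfTrace U x) := by
  rw [Complex.mul_re, Complex.conj_re, Complex.conj_im, im_polyakovTrace_eq_zero U x]
  unfold halfTrace
  ring

/-- **The pointwise inequality behind (3.2)**: for `a, b ∈ [-1, 1]`,
`ab ≥ 1 - (1 - |a|) - (1 - |b|) - 2 · 1{a, b in opposite hemispheres}` (if the signs agree,
`ab = |a||b| ≥ |a| + |b| - 1`; otherwise `ab ≥ -1`). [cite: TomboulisYaffe1985, §III.A eq. (3.2) (p. 321)] -/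
theorem mul_ge_of_abs_le_one {a b : ℝ} (ha : |a| ≤ 1) (hb : |b| ≤ 1) :
    1 - (1 - |a|) - (1 - |b|) - 2 * (if (0 ≤ a ↔ 0 ≤ b) then 0 else 1) ≤ a * b := by
  rw [abs_le] at ha hb
  by_cases h0a : 0 ≤ a <;> by_cases h0b : 0 ≤ b
  · rw [if_pos (iff_of_true h0a h0b), abs_of_nonneg h0a, abs_of_nonneg h0b]
    nlinarith
  · rw [if_neg (fun h => h0b (h.1 h0a)), abs_of_nonneg h0a, abs_of_neg (lt_of_not_ge h0b)]
    nlinarith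
  · rw [if_neg (fun h => h0a (h.2 h0b)), abs_of_neg (lt_of_not_ge h0a), abs_of_nonneg h0b]
    nlinarith
  · rw [if_pos (iff_of_false h0a h0b), abs_of_neg (lt_of_not_ge h0a), abs_of_neg (lt_of_not_ge h0b)]
    nlinarith

/-- The half-trace depends continuously on the configuration. [folklore] -/
private theorem continuous_halfTrace (y : Fin d → ZMod L) : Continuous fun U : Config d L₀ L SU2 => halfTrace U y :=
  (Complex.continuous_re.comp (continuous_polyakovTrace (fundamentalRep (Fin 2))
    (continuous_fundamentalRep (Fin 2)) y)).div_const 2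

variable [NeZero L₀] [NeZero L]

/-- The upper hemisphere `{½ tr Ω[y] ≥ 0}` is a measurable event. [folklore] -/
private theorem measurableSet_hemisphere (y : Fin d → ZMod L) :
    MeasurableSet {U : Config d L₀ L SU2 | 0 ≤ halfTrace U y} :=
  (isClosed_le continuous_const (continuous_halfTrace y)).measurableSet

/-- A single domain wall is a measurable event. [folklore] -/
private theorem measurableSet_wall (y y' : Fin d → ZMod L) :
    MeasurableSet {U : Config d L₀ L SU2 | ¬ (0 ≤ halfTrace U y ↔ 0 ≤ halfTrace U y')} := by
  have h : {U : Config d L₀ L SU2 | ¬ (0 ≤ halfTrace U y ↔ 0 ≤ halfTrace U y')} =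
      symmDiff {U | 0 ≤ halfTrace U y} {U | 0 ≤ halfTrace U y'} := by
    ext U
    simp only [Set.mem_setOf_eq, Set.mem_symmDiff]
    tauto
  rw [h]
  exact (measurableSet_hemisphere y).symmDiff (measurableSet_hemisphere y')

/-- The domain-wall event of a finite bond set is measurable. [folklore] -/
private theorem measurableSet_wallEvent (B : Finset ((Fin d → ZMod L) × Fin d)) :
    MeasurableSet (wallEvent (d := d) (L₀ := L₀) (L := L) B) := by
  have h : wallEvent (d := d) (L₀ := L₀) (L := L) B =
      ⋂ b ∈ B, {U | ¬ (0 ≤ halfTrace U b.1 ↔ 0 ≤ halfTrace U (b.1 + Pi.single b.2 1))} := by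
    ext U; simp [wallEvent]
  rw [h]
  exact Finset.measurableSet_biInter B fun b _ => measurableSet_wall _ _

/-- Indicators of measurable events are integrable against the weight. [folklore] -/
private theorem integrable_indicator_mul_weight (JE JM : ℝ) {E : Set (Config d L₀ L SU2)} (hE : MeasurableSet E) :
    Integrable (fun U => E.indicator (1 : Config d L₀ L SU2 → ℝ) U * weight (fundamentalRep (Fin 2)) JE JM U)
      (haar d L₀ L SU2) := by
  refine integrable_mul_weight (fundamentalRep (Fin 2)) (continuous_fundamentalRep (Fin 2)) JE JM
    ((aestronglyMeasurable_indicator_iff hE).2 aestronglyMeasurable_const) (C := 1) fun U => ?_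
  by_cases hU : U ∈ E
  · rw [Set.indicator_of_mem hU]; simp
  · rw [Set.indicator_of_notMem hU]; simp

end SU2

/-! ### §3 Peierls' argument in a coordinate plane of `(ℤ/L)^d` (§III.B (3.4)–(3.8), with the
Fröhlich–Lieb torus contour count of the tree in place of App. II) -/

section Plane

variable {d L : ℕ}

/-- The coordinate `(e_i, e_j)`-plane of the spatial torus `(ℤ/L)^d` through the origin, parametrised
by the planar torus `(ℤ/L)²`. [cite: FrohlichLieb1978, §I.C Definition 1] -/
def planeMap (i j : Fin d) (p : TorusSite 2 L) : Fin d → ZMod L :=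
  Pi.single i (p 0) + Pi.single j (p 1)

/-- The spatial direction of the planar step `k ∈ {0, 1}`. [folklore] -/
def planeDir (i j : Fin d) (k : Fin 2) : Fin d := if k = 0 then i else j

/-- The plane passes through the origin. [folklore] -/
private theorem planeMap_zero (i j : Fin d) : planeMap i j (0 : TorusSite 2 L) = 0 := by
  simp [planeMap]

/-- A planar nearest-neighbour step is a spatial nearest-neighbour step:
`ι(p + e_k) = ι(p) + e_{dir k}`. [folklore] -/
private theorem planeMap_add_single (i j : Fin d) (p : TorusSite 2 L) (k : Fin 2) :
    planeMap i j (p + Pi.single k 1) = planeMap i j p + Pi.single (planeDir i j k) (1 : ZMod L) := by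
  fin_cases k
  · simp only [planeMap, planeDir, Pi.add_apply, Pi.single_eq_same, Fin.zero_eta, Fin.isValue,
      if_true, ne_eq, one_ne_zero, not_false_eq_true, Pi.single_eq_of_ne, add_zero, Pi.single_add]
    abel
  · simp only [planeMap, planeDir, Pi.add_apply, Pi.single_eq_same, Fin.mk_one, Fin.isValue,
      one_ne_zero, if_false, ne_eq, zero_ne_one, not_false_eq_true, Pi.single_eq_of_ne, add_zero,
      Pi.single_add]
    abel

/-- The plane embedding is injective (`i ≠ j`). [folklore] -/
private theorem planeMap_injective {i j : Fin d} (hij : i ≠ j) : Function.Injective (planeMap (L := L) i j) := by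
  intro p q h
  have hi := congr_fun h i
  have hj := congr_fun h j
  simp only [planeMap, Pi.add_apply, Pi.single_eq_same, Pi.single_eq_of_ne hij,
    Pi.single_eq_of_ne hij.symm, add_zero, zero_add] at hi hj
  funext k
  fin_cases k
  · exact hi
  · exact hj

/-- The planar step directions are distinct (`i ≠ j`). [folklore] -/
private theorem planeDir_injective {i j : Fin d} (hij : i ≠ j) : Function.Injective (planeDir i j) := by
  intro k k' h
  fin_cases k <;> fin_cases k' <;> simp_all [planeDir, hij.symm]

/-- A point on the first axis of the plane is the axis point `c e_i` of `(ℤ/L)^d`. [folklore] -/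
private theorem planeMap_single_zero (i j : Fin d) (c : ZMod L) :
    planeMap i j (Pi.single (0 : Fin 2) c : TorusSite 2 L) = Pi.single i c := by
  simp [planeMap]

/-- Planar nearest-neighbour steps are edges of the torus graph (`L ≥ 2`). [cite: FrohlichLieb1978, §I.C Definition 1] -/
private theorem adj_add_single (hL : 2 ≤ L) (x : TorusSite 2 L) (k : Fin 2) :
    (torusGraph 2 L).Adj x (x + Pi.single k 1) := by
  rw [torusGraph_adj_iff]
  refine ⟨fun h => ?_, Or.inl ⟨k, rfl⟩⟩
  have h1 := congr_fun h k
  simp only [Pi.add_apply, Pi.single_eq_same, left_eq_add] at h1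
  haveI : Fact (1 < L) := ⟨hL⟩
  exact one_ne_zero h1

variable [NeZero L]

variable (L) in
/-- **The bonds of a planar contour**, read in `(ℤ/L)^d`: the cut keys `(y, k)` of `A ⊆ (ℤ/L)²`
(bonds `(y, y + e_k)` with exactly one endpoint in `A`, Fröhlich–Lieb's `∂A`) mapped to the spatial
bonds `(ι y, dir k)`. [cite: FrohlichLieb1978, §I.C Definition 1] -/
def planeBonds (i j : Fin d) (A : Finset (TorusSite 2 L)) : Finset ((Fin d → ZMod L) × Fin d) :=
  (cutKeys L A).image fun e => (planeMap i j e.1, planeDir i j e.2)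

/-- `|planeBonds A| = |∂A|`. [cite: FrohlichLieb1978, §I.C Definition 1] -/
theorem card_planeBonds {i j : Fin d} (hij : i ≠ j) (A : Finset (TorusSite 2 L)) :
    (planeBonds L i j A).card = (cutKeys L A).card := by
  refine Finset.card_image_of_injective _ fun e e' h => ?_
  simp only [Prod.mk.injEq] at h
  exact Prod.ext (planeMap_injective hij h.1) (planeDir_injective hij h.2)

/-- Pointwise union bound for indicators over a `Finset`-indexed union. [folklore] -/
private theorem indicator_biUnion_le_sum {α κ : Type*} (s : Finset κ) (E : κ → Set α) (x : α) :
    (⋃ k ∈ s, E k).indicator (1 : α → ℝ) x ≤ ∑ k ∈ s, (E k).indicator 1 x := by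
  classical
  by_cases hx : x ∈ ⋃ k ∈ s, E k
  · rw [Set.indicator_of_mem hx, Pi.one_apply]
    obtain ⟨k, hk, hxk⟩ := Set.mem_iUnion₂.1 hx
    refine le_trans (le_of_eq (Set.indicator_of_mem hxk (1 : α → ℝ)).symm) ?_
    exact Finset.single_le_sum (f := fun k => (E k).indicator (1 : α → ℝ) x)
      (fun k _ => Set.indicator_nonneg (fun _ _ => zero_le_one) x) hk
  · rw [Set.indicator_of_notMem hx]
    exact Finset.sum_nonneg fun k _ => Set.indicator_nonneg (fun _ _ => zero_le_one) x

/-- Monotonicity of indicators in the set. [folklore] -/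
private theorem indicator_le_indicator_of_subset' {α : Type*} {E F : Set α} (h : E ⊆ F) (x : α) :
    E.indicator (1 : α → ℝ) x ≤ F.indicator 1 x :=
  Set.indicator_le_indicator_of_subset h (fun _ => zero_le_one) x

variable {L₀ : ℕ}

open Classical in
/-- **The contour of a configuration** (Fröhlich–Lieb's Definition 1 for the hemisphere colouring
`y ↦ [Ω[ι y] in the hemisphere of Ω[ι m]]` of the plane): if the Polyakov loops at `ι m` and `ι q` lie
in opposite hemispheres, the separating set `A ∋ m`, `A ∌ q` of the cluster of `m` has a domain wall
across EVERY bond of `∂A` — TY's resummation (3.4)–(3.5) of the sets `Q ∋ 0`, `Q ∌ x` into contours.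
[cite: TomboulisYaffe1985, §III.B eqs. (3.4)–(3.5) (p. 322)] [cite: FrohlichLieb1978, §I.C Definition 1 and (1.30)] -/
theorem wall_subset_iUnion_wallEvent (hL : 1 < L) (i j : Fin d) (m q : TorusSite 2 L) :
    {U : Config d L₀ L SU2 | ¬ (0 ≤ halfTrace U (planeMap i j m) ↔ 0 ≤ halfTrace U (planeMap i j q))} ⊆
      ⋃ A ∈ (Finset.univ.filter fun A => IsSeparatingSet L A m q),
        wallEvent (d := d) (L₀ := L₀) (L := L) (planeBonds L i j A) := by
  intro U hU
  set c : TorusSite 2 L → Bool := fun y =>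
    decide ((0 ≤ halfTrace U (planeMap i j y)) ↔ (0 ≤ halfTrace U (planeMap i j m))) with hc
  have hcm : c m = true := by simp [hc]
  have hcq : c q = false := by
    simp only [hc, decide_eq_false_iff_not]
    exact fun h => hU h.symm
  refine Set.mem_iUnion₂.2 ⟨sepSet c m q,
    Finset.mem_filter.2 ⟨Finset.mem_univ _, isSeparatingSet_sepSet hL hcm hcq⟩, ?_⟩
  intro b hb
  unfold planeBonds at hb
  obtain ⟨e, he, rfl⟩ := Finset.mem_image.1 hb
  change ¬ (0 ≤ halfTrace U (planeMap i j e.1) ↔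
    0 ≤ halfTrace U (planeMap i j e.1 + Pi.single (planeDir i j e.2) 1))
  rw [← planeMap_add_single]
  have hcut := mem_cutKeys.1 he
  have hadj := adj_add_single (by omega) e.1 e.2
  by_cases h1 : e.1 ∈ sepSet c m q
  · have h2 : e.1 + Pi.single e.2 1 ∉ sepSet c m q := fun h => hcut ⟨fun _ => h, fun _ => h1⟩
    obtain ⟨hu, hv⟩ := sepSet_compatible hcm hcq h1 h2 hadj
    simp only [hc, decide_eq_true_eq, decide_eq_false_iff_not] at hu hv
    exact fun h => hv (h.symm.trans hu)
  · have h2 : e.1 + Pi.single e.2 1 ∈ sepSet c m q := by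
      by_contra h; exact hcut ⟨fun h' => absurd h' h1, fun h' => absurd h' h⟩
    obtain ⟨hu, hv⟩ := sepSet_compatible hcm hcq h2 h1 hadj.symm
    simp only [hc, decide_eq_true_eq, decide_eq_false_iff_not] at hu hv
    exact fun h => hv (h.trans hu)

variable [NeZero L₀]

/-- ★ **Peierls' estimate in a coordinate plane, uniformly in the volume** (§III.B (3.8)): if every
set `B` of spatial bonds carries domain walls with probability `≤ K^{|B|}` (the contour bound (3.6)),
then for `L ≥ 3` and `ρ = 4·19⁶·K < 1` the Polyakov loops at any two sites `ι m`, `ι q` of a coordinate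
plane lie in opposite hemispheres with probability `≤ Σ_{A separating} K^{|∂A|} ≤ 4ρ/(1-ρ)²` — union
bound over the contour of the configuration and the tree's volume-uniform torus contour count
`sum_pow_card_cutKeys_le_geom` (TY: `Σ_{|γ| ≥ 2d} N(|γ|) K^{|γ|}` with App. II's `N(|γ|) ≤ 3^{|γ|}`).
[cite: TomboulisYaffe1985, §III.B eqs. (3.5)–(3.8) (pp. 322–323) and App. II (pp. 333–334)] [cite: FrohlichLieb1978, Thm. 1.1 and Cor. 1.2, eqs. (1.30)–(1.33)] -/
theorem expectation_wall_plane_le (hL : 2 < L) {i j : Fin d} (hij : i ≠ j) {JE JM K : ℝ}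
    (hK : 0 ≤ K) (hρ : 4 * 19 ^ 6 * K < 1)
    (hB : ∀ B : Finset ((Fin d → ZMod L) × Fin d),
      expectation (fundamentalRep (Fin 2)) JE JM
        ((wallEvent (d := d) (L₀ := L₀) (L := L) B).indicator 1) ≤ K ^ B.card)
    (m q : TorusSite 2 L) :
    expectation (fundamentalRep (Fin 2)) JE JM
        ({U : Config d L₀ L SU2 | ¬ (0 ≤ halfTrace U (planeMap i j m) ↔
          0 ≤ halfTrace U (planeMap i j q))}.indicator 1) ≤
      4 * (4 * 19 ^ 6 * K) / (1 - 4 * 19 ^ 6 * K) ^ 2 := by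
  classical
  have hL1 : 1 < L := by omega
  have hρc := continuous_fundamentalRep (Fin 2)
  set 𝒜 : Finset (Finset (TorusSite 2 L)) := Finset.univ.filter fun A => IsSeparatingSet L A m q
    with h𝒜
  have hint : ∀ A : Finset (TorusSite 2 L), Integrable (fun U => (wallEvent (d := d) (L₀ := L₀)
      (L := L) (planeBonds L i j A)).indicator (1 : Config d L₀ L SU2 → ℝ) U *
        weight (fundamentalRep (Fin 2)) JE JM U) (haar d L₀ L SU2) := fun A =>
    integrable_indicator_mul_weight JE JM (measurableSet_wallEvent _)
  calc expectation (fundamentalRep (Fin 2)) JE JM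
        ({U : Config d L₀ L SU2 | ¬ (0 ≤ halfTrace U (planeMap i j m) ↔
          0 ≤ halfTrace U (planeMap i j q))}.indicator 1)
      ≤ expectation (fundamentalRep (Fin 2)) JE JM (fun U => ∑ A ∈ 𝒜,
          (wallEvent (d := d) (L₀ := L₀) (L := L) (planeBonds L i j A)).indicator 1 U) := by
        refine expectation_mono_of_integrable (fundamentalRep (Fin 2)) hρc JE JM
          (integrable_indicator_mul_weight JE JM (measurableSet_wall _ _)) ?_ fun U => ?_
        · simp_rw [Finset.sum_mul]
          exact integrable_finsetSum 𝒜 fun A _ => hint A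
        · exact (indicator_le_indicator_of_subset' (wall_subset_iUnion_wallEvent hL1 i j m q) U).trans
            (indicator_biUnion_le_sum 𝒜 _ U)
    _ = ∑ A ∈ 𝒜, expectation (fundamentalRep (Fin 2)) JE JM
          ((wallEvent (d := d) (L₀ := L₀) (L := L) (planeBonds L i j A)).indicator 1) :=
        expectation_finset_sum (fundamentalRep (Fin 2)) JE JM 𝒜 _ fun A _ => hint A
    _ ≤ ∑ A ∈ 𝒜, K ^ (cutKeys L A).card :=
        Finset.sum_le_sum fun A _ => by rw [← card_planeBonds hij A]; exact hB _
    _ ≤ 4 * (4 * 19 ^ 6 * K) / (1 - 4 * 19 ^ 6 * K) ^ 2 :=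
        sum_pow_card_cutKeys_le_geom hL1 m q 𝒜 (fun A hA => (Finset.mem_filter.1 hA).2) hK hρ

end Plane

/-! ### §4 From the plane to all separations: telescoping along the axes and translation invariance -/

section Chain

variable {d L₀ L : ℕ}

/-- The partial sums `y_n = Σ_{i<n} x_i e_i` of a spatial vector `x`. [folklore] -/
def partialSite (x : Fin d → ZMod L) (n : ℕ) : Fin d → ZMod L := fun i => if (i : ℕ) < n then x i else 0

/-- `y_0 = 0`. [folklore] -/
private theorem partialSite_zero (x : Fin d → ZMod L) : partialSite x 0 = 0 := by
  funext i; simp [partialSite]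

/-- `y_d = x`. [folklore] -/
private theorem partialSite_self (x : Fin d → ZMod L) : partialSite x d = x := by
  funext i; simp [partialSite, i.2]

/-- `y_{n+1} = y_n + x_n e_n`. [folklore] -/
private theorem partialSite_succ (x : Fin d → ZMod L) (n : Fin d) :
    partialSite x (n + 1) = partialSite x n + Pi.single n (x n) := by
  funext i
  simp only [partialSite, Pi.add_apply]
  by_cases hi : i = n
  · subst hi
    simp
  · have hne : (i : ℕ) ≠ n := fun h => hi (Fin.ext h)
    rw [Pi.single_eq_of_ne hi]
    by_cases hlt : (i : ℕ) < n
    · rw [if_pos hlt, if_pos (by omega), add_zero]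
    · rw [if_neg hlt, if_neg (by omega), add_zero]

/-- **Telescoping of domain walls**: if the Polyakov loops at `0` and `x` lie in opposite hemispheres
then so do those at two consecutive partial sums `y_n`, `y_{n+1} = y_n + x_n e_n` for some `n < d`;
as indicators, `1{wall(0,x)} ≤ Σ_{n<d} 1{wall(y_n, y_{n+1})}`. [folklore] -/
private theorem wall_indicator_le_sum (U : Config d L₀ L SU2) (x : Fin d → ZMod L) :
    {U : Config d L₀ L SU2 | ¬ (0 ≤ halfTrace U 0 ↔ 0 ≤ halfTrace U x)}.indicator
        (1 : Config d L₀ L SU2 → ℝ) U ≤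
      ∑ n : Fin d, {U : Config d L₀ L SU2 | ¬ (0 ≤ halfTrace U (partialSite x n) ↔
        0 ≤ halfTrace U (partialSite x (n + 1)))}.indicator 1 U := by
  have hnn : ∀ n : Fin d, 0 ≤ {U : Config d L₀ L SU2 | ¬ (0 ≤ halfTrace U (partialSite x n) ↔
      0 ≤ halfTrace U (partialSite x (n + 1)))}.indicator (1 : Config d L₀ L SU2 → ℝ) U := fun n =>
    Set.indicator_nonneg (fun _ _ => zero_le_one) U
  by_cases hU : U ∈ {U : Config d L₀ L SU2 | ¬ (0 ≤ halfTrace U 0 ↔ 0 ≤ halfTrace U x)}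
  · rw [Set.indicator_of_mem hU, Pi.one_apply]
    -- some consecutive pair disagrees, else all partial sums agree with `y_0 = 0`
    by_contra hlt
    have hall : ∀ n : Fin d, (0 ≤ halfTrace U (partialSite x n) ↔
        0 ≤ halfTrace U (partialSite x (n + 1))) := by
      intro n
      by_contra hn
      have hmem : U ∈ {U : Config d L₀ L SU2 | ¬ (0 ≤ halfTrace U (partialSite x n) ↔
          0 ≤ halfTrace U (partialSite x (n + 1)))} := hn
      apply hlt
      calc (1 : ℝ) = {U : Config d L₀ L SU2 | ¬ (0 ≤ halfTrace U (partialSite x n) ↔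
            0 ≤ halfTrace U (partialSite x (n + 1)))}.indicator 1 U := by
            rw [Set.indicator_of_mem hmem, Pi.one_apply]
        _ ≤ _ := Finset.single_le_sum (fun k _ => hnn k) (Finset.mem_univ n)
    have hind : ∀ n : ℕ, n ≤ d → (0 ≤ halfTrace U 0 ↔ 0 ≤ halfTrace U (partialSite x n)) := by
      intro n hn
      induction n with
      | zero => rw [partialSite_zero]
      | succ n ih => exact (ih (by omega)).trans (hall ⟨n, by omega⟩)
    have := hind d le_rfl
    rw [partialSite_self] at this
    exact hU this
  · rw [Set.indicator_of_notMem hU]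
    exact Finset.sum_nonneg fun n _ => hnn n

/-- The half-trace of a translated configuration: `½tr Ω[y](τ_a U) = ½tr Ω[y + a](U)`. [folklore] -/
private theorem halfTrace_translate (a : Fin d → ZMod L) (U : Config d L₀ L SU2) (y : Fin d → ZMod L) :
    halfTrace (translate a U) y = halfTrace U (y + a) := by
  unfold halfTrace; rw [polyakovTrace_translate]

variable [NeZero L₀] [NeZero L]

/-- **Translation invariance of the domain-wall probability**: `μ(wall(a, a + v)) = μ(wall(0, v))`.
[cite: BorgsSeiler1983, §II.3 (II.22) (p. 337)] -/
theorem expectation_wall_translate (JE JM : ℝ) (a v : Fin d → ZMod L) :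
    expectation (fundamentalRep (Fin 2)) JE JM
        ({U : Config d L₀ L SU2 | ¬ (0 ≤ halfTrace U a ↔ 0 ≤ halfTrace U (a + v))}.indicator 1) =
      expectation (fundamentalRep (Fin 2)) JE JM
        ({U : Config d L₀ L SU2 | ¬ (0 ≤ halfTrace U 0 ↔ 0 ≤ halfTrace U v)}.indicator 1) := by
  rw [← expectation_comp_translate (fundamentalRep (Fin 2)) JE JM a
    ({U : Config d L₀ L SU2 | ¬ (0 ≤ halfTrace U 0 ↔ 0 ≤ halfTrace U v)}.indicator 1)]
  congr 1
  funext U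
  simp only [Set.indicator, Set.mem_setOf_eq, halfTrace_translate, zero_add, add_comm v a,
    Pi.one_apply]

/-- Translation invariance of the point-defect expectation: `⟨1 - |½tr Ω[x]|⟩ = ⟨1 - |½tr Ω[0]|⟩`.
[cite: BorgsSeiler1983, §II.3 (II.22) (p. 337)] -/
theorem expectation_pointDefect_translate (JE JM : ℝ) (x : Fin d → ZMod L) :
    expectation (fundamentalRep (Fin 2)) JE JM (fun U : Config d L₀ L SU2 => 1 - |halfTrace U x|) =
      expectation (fundamentalRep (Fin 2)) JE JM (fun U : Config d L₀ L SU2 => 1 - |halfTrace U 0|) := by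
  rw [← expectation_comp_translate (fundamentalRep (Fin 2)) JE JM x
    (fun U : Config d L₀ L SU2 => 1 - |halfTrace U 0|)]
  congr 1
  funext U
  simp only [halfTrace_translate, zero_add]

/-- ★ **Peierls' estimate for an arbitrary separation** `x ∈ (ℤ/L)^d`, `d ≥ 2`, `L ≥ 3`: with the
contour bound (3.6) at rate `K`, `ρ = 4·19⁶K < 1`, the Polyakov loops at `0` and `x` lie in opposite
hemispheres with probability `≤ d · 4ρ/(1-ρ)²` (telescoping along the axes, translation invariance,
and the planar estimate for each axis step). [cite: TomboulisYaffe1985, §III.B eq. (3.8) (p. 323)] -/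
theorem expectation_wall_le (hd : 2 ≤ d) (hL : 2 < L) {JE JM K : ℝ} (hK : 0 ≤ K)
    (hρ : 4 * 19 ^ 6 * K < 1)
    (hB : ∀ B : Finset ((Fin d → ZMod L) × Fin d),
      expectation (fundamentalRep (Fin 2)) JE JM
        ((wallEvent (d := d) (L₀ := L₀) (L := L) B).indicator 1) ≤ K ^ B.card)
    (x : Fin d → ZMod L) :
    expectation (fundamentalRep (Fin 2)) JE JM
        ({U : Config d L₀ L SU2 | ¬ (0 ≤ halfTrace U 0 ↔ 0 ≤ halfTrace U x)}.indicator 1) ≤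
      d * (4 * (4 * 19 ^ 6 * K) / (1 - 4 * 19 ^ 6 * K) ^ 2) := by
  have hρc := continuous_fundamentalRep (Fin 2)
  set P : ℝ := 4 * (4 * 19 ^ 6 * K) / (1 - 4 * 19 ^ 6 * K) ^ 2 with hP
  -- each axis step is a planar wall probability
  have hstep : ∀ n : Fin d, expectation (fundamentalRep (Fin 2)) JE JM
      ({U : Config d L₀ L SU2 | ¬ (0 ≤ halfTrace U (partialSite x n) ↔
        0 ≤ halfTrace U (partialSite x (n + 1)))}.indicator 1) ≤ P := by
    intro n
    obtain ⟨j, hj⟩ : ∃ j : Fin d, n ≠ j := by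
      by_cases hn : (n : ℕ) = 0
      · exact ⟨⟨1, by omega⟩, fun h => by have := congrArg Fin.val h; simp [hn] at this⟩
      · exact ⟨⟨0, by omega⟩, fun h => by have := congrArg Fin.val h; simp [hn] at this⟩
    rw [partialSite_succ, expectation_wall_translate]
    have h := expectation_wall_plane_le (L₀ := L₀) hL hj hK hρ hB 0 (Pi.single 0 (x n))
    rwa [planeMap_zero, planeMap_single_zero] at h
  have hint : ∀ n : Fin d, Integrable (fun U => {U : Config d L₀ L SU2 |
      ¬ (0 ≤ halfTrace U (partialSite x n) ↔ 0 ≤ halfTrace U (partialSite x (n + 1)))}.indicator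
        (1 : Config d L₀ L SU2 → ℝ) U * weight (fundamentalRep (Fin 2)) JE JM U) (haar d L₀ L SU2) :=
    fun n => integrable_indicator_mul_weight JE JM (measurableSet_wall _ _)
  calc expectation (fundamentalRep (Fin 2)) JE JM
        ({U : Config d L₀ L SU2 | ¬ (0 ≤ halfTrace U 0 ↔ 0 ≤ halfTrace U x)}.indicator 1)
      ≤ expectation (fundamentalRep (Fin 2)) JE JM (fun U => ∑ n : Fin d,
          {U : Config d L₀ L SU2 | ¬ (0 ≤ halfTrace U (partialSite x n) ↔
            0 ≤ halfTrace U (partialSite x (n + 1)))}.indicator 1 U) := by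
        refine expectation_mono_of_integrable (fundamentalRep (Fin 2)) hρc JE JM
          (integrable_indicator_mul_weight JE JM (measurableSet_wall _ _)) ?_ fun U =>
            wall_indicator_le_sum U x
        simp_rw [Finset.sum_mul]
        exact integrable_finsetSum _ fun n _ => hint n
    _ = ∑ n : Fin d, expectation (fundamentalRep (Fin 2)) JE JM
          ({U : Config d L₀ L SU2 | ¬ (0 ≤ halfTrace U (partialSite x n) ↔
            0 ≤ halfTrace U (partialSite x (n + 1)))}.indicator 1) :=
        expectation_finset_sum (fundamentalRep (Fin 2)) JE JM _ _ fun n _ => hint n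
    _ ≤ ∑ _n : Fin d, P := Finset.sum_le_sum fun n _ => hstep n
    _ = d * P := by rw [Finset.sum_const, Finset.card_univ, Fintype.card_fin, nsmul_eq_mul]

end Chain

/-! ### §5 (3.2) with (3.8) in one periodic box; Theorem I from the disorder bounds (3.25)–(3.26) -/

section Assembly

variable {d L₀ L : ℕ} [NeZero L₀] [NeZero L]

/-- ★ **TY's (3.2) combined with the Peierls estimate (3.8), in one periodic box** (`SU(2)`, `d ≥ 2`,
`L ≥ 3`, any temporal extent and couplings): if the point-defect probability obeys
`⟨1 - |½tr Ω[0]|⟩ ≤ K` ((3.25)) and every set `B` of spatial bonds carries domain walls with probability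
`≤ K^{|B|}` ((3.26)), `ρ = 4·19⁶K < 1`, then for EVERY `x`
`G_L(x) = 4⟨½tr Ω[0] ½tr Ω[x]⟩ ≥ 4(1 - 2K - 2d · 4ρ/(1-ρ)²)`, by
`½tr Ω[0] ½tr Ω[x] ≥ 1 - (1 - |½tr Ω[0]|) - (1 - |½tr Ω[x]|) - 2·1{opposite hemispheres}` ((3.2):
"`G ≥ 1 - 4⟨P₀⁺Pₓ⁻⟩ - 2⟨1 - |½tr Ω[0]|⟩`"), translation invariance and `expectation_wall_le`.
[cite: TomboulisYaffe1985, §III.A eq. (3.2) (p. 321); §III.B eq. (3.8) (p. 323)] -/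
theorem polyakovCorrelation_ge_of_disorderBounds (hd : 2 ≤ d) (hL : 2 < L) {JE JM K : ℝ}
    (hK : 0 ≤ K) (hρ : 4 * 19 ^ 6 * K < 1)
    (hpt : expectation (fundamentalRep (Fin 2)) JE JM
      (fun U : Config d L₀ L SU2 => 1 - |halfTrace U 0|) ≤ K)
    (hB : ∀ B : Finset ((Fin d → ZMod L) × Fin d),
      expectation (fundamentalRep (Fin 2)) JE JM
        ((wallEvent (d := d) (L₀ := L₀) (L := L) B).indicator 1) ≤ K ^ B.card)
    (x : Fin d → ZMod L) :
    4 * (1 - 2 * K - 2 * (d * (4 * (4 * 19 ^ 6 * K) / (1 - 4 * 19 ^ 6 * K) ^ 2))) ≤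
      polyakovCorrelation (L₀ := L₀) (fundamentalRep (Fin 2)) JE JM x := by
  have hρc := continuous_fundamentalRep (Fin 2)
  have hZ := partitionFunction_pos (d := d) (L₀ := L₀) (L := L) (fundamentalRep (Fin 2)) hρc JE JM
  set P : ℝ := d * (4 * (4 * 19 ^ 6 * K) / (1 - 4 * 19 ^ 6 * K) ^ 2) with hP
  set pa : Config d L₀ L SU2 → ℝ := fun U => 1 - |halfTrace U 0| with hpa
  set pb : Config d L₀ L SU2 → ℝ := fun U => 1 - |halfTrace U x| with hpb
  set wl : Config d L₀ L SU2 → ℝ :=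
    {U : Config d L₀ L SU2 | ¬ (0 ≤ halfTrace U 0 ↔ 0 ≤ halfTrace U x)}.indicator 1 with hwl
  -- the pointwise inequality (3.2)
  have hptw : ∀ U, 4 * (1 - (pa U + (pb U + 2 * wl U))) ≤ 4 * (halfTrace U 0 * halfTrace U x) := by
    intro U
    have h := mul_ge_of_abs_le_one (abs_halfTrace_le_one U 0) (abs_halfTrace_le_one U x)
    have hw : wl U = if (0 ≤ halfTrace U 0 ↔ 0 ≤ halfTrace U x) then 0 else 1 := by
      by_cases hc : (0 ≤ halfTrace U 0 ↔ 0 ≤ halfTrace U x)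
      · rw [if_pos hc, hwl, Set.indicator_of_notMem]; exact fun h' => h' hc
      · rw [if_neg hc, hwl, Set.indicator_of_mem]; exacts [rfl, hc]
    rw [hw]
    linarith
  -- integrability of the three observables against the weight
  have hia : Integrable (fun U => pa U * weight (fundamentalRep (Fin 2)) JE JM U) (haar d L₀ L SU2) :=
    integrable_mul_weight (fundamentalRep (Fin 2)) hρc JE JM
      (continuous_const.sub (continuous_halfTrace 0).abs).aestronglyMeasurable (C := 1) fun U => by
        have h1 := abs_halfTrace_le_one U 0
        have h0 := abs_nonneg (halfTrace U 0)
        rw [hpa, abs_le]; constructor <;> linarith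
  have hib : Integrable (fun U => pb U * weight (fundamentalRep (Fin 2)) JE JM U) (haar d L₀ L SU2) :=
    integrable_mul_weight (fundamentalRep (Fin 2)) hρc JE JM
      (continuous_const.sub (continuous_halfTrace x).abs).aestronglyMeasurable (C := 1) fun U => by
        have h1 := abs_halfTrace_le_one U x
        have h0 := abs_nonneg (halfTrace U x)
        rw [hpb, abs_le]; constructor <;> linarith
  have hiw : Integrable (fun U => wl U * weight (fundamentalRep (Fin 2)) JE JM U) (haar d L₀ L SU2) :=
    integrable_indicator_mul_weight JE JM (measurableSet_wall 0 x)
  have hiw2 : Integrable (fun U => (2 * wl U) * weight (fundamentalRep (Fin 2)) JE JM U) (haar d L₀ L SU2) := by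
    simp_rw [mul_assoc]; exact hiw.const_mul 2
  have hibw : Integrable (fun U => (pb U + 2 * wl U) * weight (fundamentalRep (Fin 2)) JE JM U)
      (haar d L₀ L SU2) := by
    simp_rw [add_mul]; exact hib.add hiw2
  have hig : Integrable (fun U => (pa U + (pb U + 2 * wl U)) * weight (fundamentalRep (Fin 2)) JE JM U)
      (haar d L₀ L SU2) := by
    have : (fun U => (pa U + (pb U + 2 * wl U)) * weight (fundamentalRep (Fin 2)) JE JM U) =
        fun U => pa U * weight (fundamentalRep (Fin 2)) JE JM U +
          (pb U + 2 * wl U) * weight (fundamentalRep (Fin 2)) JE JM U := by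
      funext U; ring
    rw [this]; exact hia.add hibw
  have hi1 : Integrable (fun U => (1 : ℝ) * weight (fundamentalRep (Fin 2)) JE JM U) (haar d L₀ L SU2) :=
    (integrable_of_continuous (continuous_weight (fundamentalRep (Fin 2)) hρc JE JM)).const_mul 1
  have hiab : Integrable (fun U => (4 * (halfTrace U 0 * halfTrace U x)) *
      weight (fundamentalRep (Fin 2)) JE JM U) (haar d L₀ L SU2) :=
    integrable_mul_weight (fundamentalRep (Fin 2)) hρc JE JM
      (continuous_const.mul ((continuous_halfTrace 0).mul (continuous_halfTrace x))).aestronglyMeasurable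
      (C := 4) fun U => by
        have h0 := abs_halfTrace_le_one U 0
        have hx := abs_halfTrace_le_one U x
        rw [abs_mul, abs_mul, abs_of_pos (by norm_num : (0:ℝ) < 4)]
        nlinarith [abs_nonneg (halfTrace U 0), abs_nonneg (halfTrace U x)]
  have hicomb : Integrable (fun U => (4 * (1 - (pa U + (pb U + 2 * wl U)))) *
      weight (fundamentalRep (Fin 2)) JE JM U) (haar d L₀ L SU2) := by
    have : (fun U => (4 * (1 - (pa U + (pb U + 2 * wl U)))) * weight (fundamentalRep (Fin 2)) JE JM U) =
        fun U => 4 * ((1 : ℝ) * weight (fundamentalRep (Fin 2)) JE JM U) -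
          4 * ((pa U + (pb U + 2 * wl U)) * weight (fundamentalRep (Fin 2)) JE JM U) := by
      funext U; ring
    rw [this]; exact (hi1.const_mul 4).sub (hig.const_mul 4)
  -- linearity: the expectation of the combination
  have hcomb : expectation (fundamentalRep (Fin 2)) JE JM (fun U => 4 * (1 - (pa U + (pb U + 2 * wl U)))) =
      4 * (1 - (expectation (fundamentalRep (Fin 2)) JE JM pa +
        (expectation (fundamentalRep (Fin 2)) JE JM pb + 2 * expectation (fundamentalRep (Fin 2)) JE JM wl))) := by
    rw [expectation_const_mul', expectation_sub' (fundamentalRep (Fin 2)) JE JM hi1 hig,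
      expectation_const (fundamentalRep (Fin 2)) hZ, expectation_add' (fundamentalRep (Fin 2)) JE JM hia hibw,
      expectation_add' (fundamentalRep (Fin 2)) JE JM hib hiw2, expectation_const_mul']
  -- the three disorder bounds
  have hEa : expectation (fundamentalRep (Fin 2)) JE JM pa ≤ K := hpt
  have hEb : expectation (fundamentalRep (Fin 2)) JE JM pb ≤ K := by
    rw [hpb, expectation_pointDefect_translate]; exact hpt
  have hEw : expectation (fundamentalRep (Fin 2)) JE JM wl ≤ P := expectation_wall_le hd hL hK hρ hB x
  -- assemble
  have hG : polyakovCorrelation (L₀ := L₀) (fundamentalRep (Fin 2)) JE JM x =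
      expectation (fundamentalRep (Fin 2)) JE JM (fun U : Config d L₀ L SU2 =>
        4 * (halfTrace U 0 * halfTrace U x)) := by
    unfold polyakovCorrelation
    congr 1
    funext U
    exact polyakovIntegrand_eq_halfTrace U x
  rw [hG]
  calc 4 * (1 - 2 * K - 2 * P)
      ≤ 4 * (1 - (expectation (fundamentalRep (Fin 2)) JE JM pa +
          (expectation (fundamentalRep (Fin 2)) JE JM pb +
            2 * expectation (fundamentalRep (Fin 2)) JE JM wl))) := by linarith
    _ = expectation (fundamentalRep (Fin 2)) JE JM (fun U => 4 * (1 - (pa U + (pb U + 2 * wl U)))) :=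
        hcomb.symm
    _ ≤ expectation (fundamentalRep (Fin 2)) JE JM (fun U : Config d L₀ L SU2 =>
          4 * (halfTrace U 0 * halfTrace U x)) :=
        expectation_mono_of_integrable (fundamentalRep (Fin 2)) hρc JE JM hicomb hiab hptw

/-- `4ρ/(1-ρ)² ≤ 16ρ` for `0 ≤ ρ ≤ 1/2`. [folklore] -/
private theorem geom_bound_le {ρ : ℝ} (h0 : 0 ≤ ρ) (h : ρ ≤ 1 / 2) : 4 * ρ / (1 - ρ) ^ 2 ≤ 16 * ρ := by
  rw [div_le_iff₀ (by nlinarith)]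
  have h1 : 1 / 4 ≤ (1 - ρ) ^ 2 := by nlinarith
  calc 4 * ρ = 16 * ρ * (1 / 4) := by ring
    _ ≤ 16 * ρ * (1 - ρ) ^ 2 := mul_le_mul_of_nonneg_left h1 (by positivity)

/-- ★★ **Tomboulis–Yaffe's Theorem I from their disorder bounds (3.25)–(3.26)** — the content of
§III.A eq. (3.2), §III.B (Peierls' argument (3.4)–(3.8)) and App. II (contour counting), PROVED:
if, along the fixed-coupling hyperbola `(J_E, J_M) = (γθ, γ/θ)` at temporal extent `L₀ = 2^a`, there
are `θ₀` and a rate `K(θ) → 0` (`θ → ∞`, i.e. `T → ∞`) such that above `θ₀`, uniformly in the spatial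
side `L = 2^k ≥ 4`,
(3.25) the point-defect probability `⟨1 - |½tr Ω[0]|⟩ ≤ K(θ)` and
(3.26) for every finite set `B` of spatial nearest-neighbour bonds the domain-wall probability
`⟨∏_{⟨yy'⟩∈B} (P⁺_y P⁻_{y'} + P⁻_y P⁺_{y'})⟩ ≤ K(θ)^{|B|}` (TY's contour bound (3.6)
`⟨∏_{⟨yy'⟩∈γ} P⁺_y P⁻_{y'}⟩ ≤ K^{|γ|}`, which their chessboard estimate (3.10) yields for every bond set
and every orientation; the unoriented form follows with `K ↦ 2K`),
then `PolyakovTwoPointLowerBound` holds: `G_L(x) ≥ 4e^{-μ(θ)}` for all `x`, uniformly in `L`, with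
`μ(θ) → 0`.  The hypotheses are exactly what TY's §III.C ("Disorder probabilities": chessboard
estimates (3.9)–(3.10), the transfer-matrix reduction (3.11)–(3.15) of App. III, the XY-model
comparison (3.16)–(3.22) of App. IV, giving (3.23)–(3.26) with `K ~ s (4β_>)^{-(d-1)/d} → 0`) proves
and are NOT proved here. [cite: TomboulisYaffe1985, §III Theorem I (p. 320); §III.A eq. (3.2) (p. 321); §III.B eqs. (3.4)–(3.8) (pp. 322–323); §III.C eqs. (3.25)–(3.26) (p. 325); App. II (pp. 333–334)] -/
theorem polyakovTwoPointLowerBound_of_disorderBounds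
    (h : ∀ γ : ℝ, 0 < γ → ∀ d : ℕ, 2 ≤ d → ∀ a : ℕ,
      ∃ θ₀ : ℝ, ∃ K : ℝ → ℝ, Tendsto K atTop (𝓝 0) ∧
        ∀ θ : ℝ, θ₀ < θ → ∀ k : ℕ, 2 ≤ k →
          expectation (d := d) (L₀ := 2 ^ a) (L := 2 ^ k) (fundamentalRep (Fin 2)) (γ * θ) (γ / θ)
              (fun U => 1 - |halfTrace U 0|) ≤ K θ ∧
          ∀ B : Finset ((Fin d → ZMod (2 ^ k)) × Fin d),
            expectation (d := d) (L₀ := 2 ^ a) (L := 2 ^ k) (fundamentalRep (Fin 2)) (γ * θ) (γ / θ)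
              ((wallEvent B).indicator 1) ≤ K θ ^ B.card) :
    PolyakovTwoPointLowerBound := by
  intro γ hγ d hd a
  obtain ⟨θ₀, K, hK, hθ⟩ := h γ hγ d hd a
  -- the constant of the final bound and the smallness threshold
  set C : ℝ := 2 + 128 * 19 ^ 6 * d with hC
  have hCpos : 0 < C := by rw [hC]; positivity
  set δ : ℝ := 1 / (2 * C) with hδ
  have hδpos : 0 < δ := by rw [hδ]; positivity
  obtain ⟨θ₁, hθ₁⟩ := eventually_atTop.1 (hK.eventually (gt_mem_nhds hδpos))
  -- `μ(θ) = -log (1 - min (max (C K(θ)) 0) (1/2))`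
  set m : ℝ → ℝ := fun θ => min (max (C * K θ) 0) (1 / 2) with hm
  refine ⟨max θ₀ θ₁, fun θ => -Real.log (1 - m θ), ?_, fun θ hθθ k hk x => ?_⟩
  · -- `μ → 0`
    have hmt : Tendsto m atTop (𝓝 (min (max (C * 0) 0) (1 / 2))) :=
      ((hK.const_mul C).max tendsto_const_nhds).min tendsto_const_nhds
    rw [mul_zero, max_self, min_eq_left (by norm_num : (0:ℝ) ≤ 1 / 2)] at hmt
    have h1 : Tendsto (fun θ => 1 - m θ) atTop (𝓝 (1 - 0)) := tendsto_const_nhds.sub hmt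
    rw [sub_zero] at h1
    have h2 : Tendsto (fun θ => Real.log (1 - m θ)) atTop (𝓝 (Real.log 1)) :=
      (Real.continuousAt_log one_ne_zero).tendsto.comp h1
    rw [Real.log_one] at h2
    simpa using h2.neg
  · -- the bound above the threshold
    have hθ0 : θ₀ < θ := lt_of_le_of_lt (le_max_left _ _) hθθ
    have hθ1 : θ₁ ≤ θ := (le_max_right _ _).trans hθθ.le
    obtain ⟨hpt, hB⟩ := hθ θ hθ0 k hk
    have hKδ : K θ < δ := hθ₁ θ hθ1
    -- `K θ ≥ 0` from the point-defect bound (the observable is nonnegative)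
    have hρc := continuous_fundamentalRep (Fin 2)
    have hK0 : 0 ≤ K θ := by
      refine le_trans ?_ hpt
      have hZ := partitionFunction_pos (d := d) (L₀ := 2 ^ a) (L := 2 ^ k) (fundamentalRep (Fin 2)) hρc
        (γ * θ) (γ / θ)
      rw [← expectation_const (d := d) (L₀ := 2 ^ a) (L := 2 ^ k) (fundamentalRep (Fin 2)) hZ 0]
      refine expectation_mono_of_integrable (fundamentalRep (Fin 2)) hρc _ _ ?_ ?_ fun U => ?_
      · simp_rw [zero_mul]; exact integrable_zero _ _ _
      · exact integrable_mul_weight (fundamentalRep (Fin 2)) hρc _ _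
          (continuous_const.sub (continuous_halfTrace 0).abs).aestronglyMeasurable (C := 1) fun U => by
            have h1 := abs_halfTrace_le_one U 0
            have h0 := abs_nonneg (halfTrace U 0)
            rw [abs_le]; constructor <;> linarith
      · have h1 := abs_halfTrace_le_one U 0
        linarith
    have hCK : C * K θ ≤ 1 / 2 := by
      have : C * K θ ≤ C * δ := mul_le_mul_of_nonneg_left hKδ.le hCpos.le
      rw [hδ] at this
      calc C * K θ ≤ C * (1 / (2 * C)) := this
        _ = 1 / 2 := by field_simp
    have hCK0 : 0 ≤ C * K θ := mul_nonneg hCpos.le hK0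
    have hmθ : m θ = C * K θ := by
      rw [hm]; simp only
      rw [max_eq_left hCK0, min_eq_left hCK]
    -- `ρ = 4·19⁶ K ≤ 1/2`
    have hρhalf : 4 * 19 ^ 6 * K θ ≤ 1 / 2 := by
      have h19 : (4 * 19 ^ 6 : ℝ) ≤ C := by
        rw [hC]
        have : (2:ℝ) ≤ d := by exact_mod_cast hd
        nlinarith
      nlinarith
    have hρ1 : 4 * 19 ^ 6 * K θ < 1 := by linarith
    have hL : 2 < 2 ^ k := by
      calc 2 = 2 ^ 1 := (pow_one 2).symm
        _ < 2 ^ k := Nat.pow_lt_pow_right (by norm_num) (by omega)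
    have hmain := polyakovCorrelation_ge_of_disorderBounds (L₀ := 2 ^ a) hd hL hK0 hρ1 hpt hB x
    -- compare the explicit bound with `4 e^{-μ} = 4 (1 - C K)`
    have hgeom := geom_bound_le (by positivity : (0:ℝ) ≤ 4 * 19 ^ 6 * K θ) hρhalf
    have hexp : Real.exp (-(-Real.log (1 - m θ))) = 1 - C * K θ := by
      rw [neg_neg, hmθ, Real.exp_log (by linarith)]
    rw [hexp]
    refine le_trans ?_ hmain
    have hd0 : (0:ℝ) ≤ d := Nat.cast_nonneg d
    have : (d : ℝ) * (4 * (4 * 19 ^ 6 * K θ) / (1 - 4 * 19 ^ 6 * K θ) ^ 2) ≤ d * (16 * (4 * 19 ^ 6 * K θ)) :=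
      mul_le_mul_of_nonneg_left hgeom hd0
    rw [hC]
    nlinarith

end Assembly

/-! ### §6 The centre flip of the time-`0` links in the lattice plane `y_i = 0` (the change of
variables of §III.A: "a change of variables … which flipped the signs of the set of timelike links
`{l₀(n) | n₀ = n₁ = 0}`. This moves the coclosed set of plaquettes with negative couplings from `S₀₁`
to `S'₀₁`") -/

section Flip

variable {d L₀ L : ℕ} {G : Type*} [Group G] {N : ℕ} (ρ : G →* Matrix (Fin N) (Fin N) ℂ)

variable (L₀ L) in
/-- The adjacent stack `S'_{0i} = {P_{0i}(n) | n₀ = 0, n_i = −1}`, the image of the stack `S_{0i}` of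
(2.8) under the flip of the time-like links `{l₀(n) | n₀ = n_i = 0}`. [cite: TomboulisYaffe1985, §III.A, text after eq. (3.2) (p. 321)] -/
def adjFluxStack [NeZero L₀] [NeZero L] (i : Fin d) : Finset (FiniteTemperature.Site d L₀ L) :=
  Finset.univ.filter fun x => x.1 = 0 ∧ x.2 i = -1

/-- The coupling-flipping factor on the adjacent stack, `τ[S'_{0i}] = ∏_{p ∈ S'_{0i}} e^{−2J_E Re tr ρ(U_p)}`.
[cite: TomboulisYaffe1985, §II.A eq. (2.8) (p. 317); §III.A (p. 321)] -/
def adjFluxObs [NeZero L₀] [NeZero L] (JE : ℝ) (i : Fin d) (U : Config d L₀ L G) : ℝ :=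
  ∏ x ∈ adjFluxStack L₀ L i,
    Real.exp (-(2 * JE * (ρ (FiniteTemperature.plaquette U x none (some i))).trace.re))

/-- **The flip**: left-multiply the time-like link variables `U((0, y), time)` with `y_i = 0` by a
(central) element `z`. [cite: TomboulisYaffe1985, §III.A, text after eq. (3.2) (p. 321)] -/
def sliceFlip (i : Fin d) (z : G) (U : Config d L₀ L G) : Config d L₀ L G :=
  fun e => (if e.2 = none ∧ e.1.1 = 0 ∧ e.1.2 i = 0 then z else 1) * U e

/-- The flip factor of the time-like link at `(t, y)`. [folklore] -/
private def flipFactor (i : Fin d) (z : G) (t : ZMod L₀) (y : Fin d → ZMod L) : G :=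
  if t = 0 ∧ y i = 0 then z else 1

/-- The flip factor is central if `z` is. [folklore] -/
private theorem flipFactor_comm (i : Fin d) {z : G} (hzc : ∀ g : G, g * z = z * g) (t : ZMod L₀)
    (y : Fin d → ZMod L) (g : G) : g * flipFactor i z t y = flipFactor i z t y * g := by
  unfold flipFactor; split_ifs
  · exact hzc g
  · rw [mul_one, one_mul]

/-- The flip factor is an involution if `z` is. [folklore] -/
private theorem flipFactor_inv (i : Fin d) {z : G} (hz2 : z * z = 1) (t : ZMod L₀) (y : Fin d → ZMod L) :
    (flipFactor i z t y)⁻¹ = flipFactor i z t y := by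
  unfold flipFactor; split_ifs
  · exact inv_eq_of_mul_eq_one_right hz2
  · exact inv_one

/-- The flip on time-like links. [folklore] -/
private theorem sliceFlip_none (i : Fin d) (z : G) (U : Config d L₀ L G) (t : ZMod L₀) (y : Fin d → ZMod L) :
    sliceFlip i z U ((t, y), none) = flipFactor i z t y * U ((t, y), none) := by
  simp [sliceFlip, flipFactor]

/-- The flip does not touch space-like links. [folklore] -/
private theorem sliceFlip_some (i : Fin d) (z : G) (U : Config d L₀ L G)
    (x : FiniteTemperature.Site d L₀ L) (j : Fin d) : sliceFlip i z U (x, some j) = U (x, some j) := by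
  simp [sliceFlip]

/-- For an involutive `z` the flip is an involution. [folklore] -/
private theorem sliceFlip_sliceFlip (i : Fin d) {z : G} (hz2 : z * z = 1) (U : Config d L₀ L G) :
    sliceFlip i z (sliceFlip i z U) = U := by
  funext e
  simp only [sliceFlip]
  split_ifs
  · rw [← mul_assoc, hz2, one_mul]
  · rw [one_mul, one_mul]

/-- **The flip preserves the a-priori measure** (it is the tree's `mulOn` with a constant family:
left invariance of the Haar measure, factor by factor). [folklore] -/
private theorem measurePreserving_sliceFlip [NeZero L₀] [NeZero L] [TopologicalSpace G]
    [IsTopologicalGroup G] [CompactSpace G] [MeasurableSpace G] [BorelSpace G] (i : Fin d) (z : G) :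
    MeasurePreserving (sliceFlip (d := d) (L₀ := L₀) (L := L) i z) (haar d L₀ L G) (haar d L₀ L G) := by
  have h := measurePreserving_mulOn (d := d) (L₀ := L₀) (L := L) (G := G)
    (Finset.univ.filter fun e : FiniteTemperature.Site d L₀ L × Dir d =>
      e.2 = none ∧ e.1.1 = 0 ∧ e.1.2 i = 0) (fun _ => z)
  have he : (mulOn (Finset.univ.filter fun e : FiniteTemperature.Site d L₀ L × Dir d =>
      e.2 = none ∧ e.1.1 = 0 ∧ e.1.2 i = 0) (fun _ => z)) = sliceFlip (d := d) (L₀ := L₀) (L := L) i z := by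
    funext U e
    simp only [sliceFlip, mulOn, Finset.mem_filter, Finset.mem_univ, true_and]
  rwa [he] at h

/-- **Space-like plaquettes are untouched** by the flip. [folklore] -/
private theorem plaquette_sliceFlip_some_some (i : Fin d) (z : G) (U : Config d L₀ L G)
    (x : FiniteTemperature.Site d L₀ L) (j k : Fin d) :
    FiniteTemperature.plaquette (sliceFlip i z U) x (some j) (some k) =
      FiniteTemperature.plaquette U x (some j) (some k) := by
  simp only [FiniteTemperature.plaquette, sliceFlip_some]

/-- **Time-like plaquettes under the flip**: `(φU)_P((t,y); 0, j) = c(t,y) c(t, y+e_j)⁻¹ · U_P`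
with the central flip factors of its two time-like links. [folklore] -/
private theorem plaquette_sliceFlip_none (i : Fin d) {z : G} (hzc : ∀ g : G, g * z = z * g)
    (U : Config d L₀ L G) (t : ZMod L₀) (y : Fin d → ZMod L) (j : Fin d) :
    FiniteTemperature.plaquette (sliceFlip i z U) (t, y) none (some j) =
      flipFactor i z t y * (flipFactor i z t (y + Pi.single j 1))⁻¹ *
        FiniteTemperature.plaquette U (t, y) none (some j) := by
  have key : ∀ a X : G, a * ((flipFactor i z t (y + Pi.single j 1))⁻¹ * X) =
      (flipFactor i z t (y + Pi.single j 1))⁻¹ * (a * X) := by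
    intro a X
    have hc : a * (flipFactor i z t (y + Pi.single j 1))⁻¹ =
        (flipFactor i z t (y + Pi.single j 1))⁻¹ * a := by
      have h := flipFactor_comm i hzc t (y + Pi.single j 1) a⁻¹
      -- `a⁻¹ c = c a⁻¹` ⇒ `a c⁻¹ = c⁻¹ a`
      have := congrArg (fun g => g⁻¹) h
      simpa [mul_inv_rev] using this.symm
    rw [← mul_assoc, hc, mul_assoc]
  simp only [FiniteTemperature.plaquette, FiniteTemperature.Site.shift, sliceFlip_none, sliceFlip_some,
    mul_inv_rev]
  simp only [mul_assoc]
  rw [key, key, key]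

/-- Time-like plaquettes in a transverse direction `j ≠ i` are untouched (their two time-like links
are flipped together or not at all). [folklore] -/
private theorem plaquette_sliceFlip_none_of_ne (i : Fin d) {z : G} (hzc : ∀ g : G, g * z = z * g)
    (U : Config d L₀ L G) (t : ZMod L₀) (y : Fin d → ZMod L) {j : Fin d} (hj : j ≠ i) :
    FiniteTemperature.plaquette (sliceFlip i z U) (t, y) none (some j) =
      FiniteTemperature.plaquette U (t, y) none (some j) := by
  rw [plaquette_sliceFlip_none i hzc]
  have : flipFactor (L₀ := L₀) i z t (y + Pi.single j 1) = flipFactor i z t y := by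
    simp [flipFactor, Pi.single_eq_of_ne hj.symm]
  rw [this, mul_inv_cancel, one_mul]

/-- **The traces of the `(time, i)` plaquettes under the flip** (`ρ(z) = −1`, `z` central,
`z² = 1`, `L ≥ 2`): the sign of `Re tr ρ(U_P)` changes exactly on the two stacks `S_{0i}` (`t = 0`,
`y_i = 0`) and `S'_{0i}` (`t = 0`, `y_i = −1`). [cite: TomboulisYaffe1985, §III.A, text after eq. (3.2) (p. 321)] -/
private theorem re_trace_plaquette_sliceFlip_same [NeZero L] (hL : 1 < L) (i : Fin d) {z : G}
    (hzc : ∀ g : G, g * z = z * g) (hz2 : z * z = 1) (hρz : ρ z = -1) (U : Config d L₀ L G)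
    (t : ZMod L₀) (y : Fin d → ZMod L) :
    (ρ (FiniteTemperature.plaquette (sliceFlip i z U) (t, y) none (some i))).trace.re =
      (if t = 0 ∧ (y i = 0 ∨ y i = -1) then -1 else 1) *
        (ρ (FiniteTemperature.plaquette U (t, y) none (some i))).trace.re := by
  haveI : Fact (1 < L) := ⟨hL⟩
  rw [plaquette_sliceFlip_none i hzc, flipFactor_inv i hz2]
  have h01 : ¬ (y i = 0 ∧ y i + 1 = 0) := by
    rintro ⟨h0, h1⟩; rw [h0, zero_add] at h1; exact one_ne_zero h1
  have hneg : ∀ M : Matrix (Fin N) (Fin N) ℂ, (ρ z * M).trace.re = -M.trace.re := fun M => by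
    rw [hρz, neg_one_mul, Matrix.trace_neg, Complex.neg_re]
  by_cases ht : t = 0
  · simp only [flipFactor, ht, true_and, Pi.add_apply, Pi.single_eq_same]
    by_cases h0 : y i = 0
    · simp [h0, hneg]
    · by_cases h1 : y i + 1 = 0
      · have hm : y i = -1 := eq_neg_of_add_eq_zero_left h1
        simp [hm, hneg]
      · have hm : ¬ y i = -1 := fun h => h1 (by rw [h]; exact neg_add_cancel 1)
        simp [h0, h1, hm]
  · simp [flipFactor, ht]

variable [NeZero L₀] [NeZero L]

/-- **The action under the flip**: minus the action changes by `−2J_E (Σ_{S} + Σ_{S'}) Re tr ρ(U_P)`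
("moves the coclosed set of plaquettes with negative couplings from `S₀₁` to `S'₀₁`").
[cite: TomboulisYaffe1985, §III.A, text after eq. (3.2) (p. 321)] -/
private theorem minusAction_sliceFlip (hL : 1 < L) (i : Fin d) {z : G} (hzc : ∀ g : G, g * z = z * g)
    (hz2 : z * z = 1) (hρz : ρ z = -1) (JE JM : ℝ) (U : Config d L₀ L G) :
    minusAction ρ JE JM (sliceFlip i z U) = minusAction ρ JE JM U -
      2 * JE * (∑ x ∈ fluxStack d L₀ L i, (ρ (FiniteTemperature.plaquette U x none (some i))).trace.re +
        ∑ x ∈ adjFluxStack L₀ L i, (ρ (FiniteTemperature.plaquette U x none (some i))).trace.re) := by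
  haveI : Fact (1 < L) := ⟨hL⟩
  unfold minusAction
  simp only [plaquette_sliceFlip_some_some]
  -- the electric sum
  have hel : ∀ x : FiniteTemperature.Site d L₀ L,
      ∑ j : Fin d, (ρ (FiniteTemperature.plaquette (sliceFlip i z U) x none (some j))).trace.re =
        ∑ j : Fin d, (ρ (FiniteTemperature.plaquette U x none (some j))).trace.re +
          (if x.1 = 0 ∧ (x.2 i = 0 ∨ x.2 i = -1) then
            -2 * (ρ (FiniteTemperature.plaquette U x none (some i))).trace.re else 0) := by
    rintro ⟨t, y⟩
    have hsplit : ∀ (f g : Fin d → ℝ), (∀ j, j ≠ i → f j = g j) →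
        ∑ j, f j = ∑ j, g j + (f i - g i) := by
      intro f g hfg
      have hf := Finset.sum_erase_add Finset.univ f (Finset.mem_univ i)
      have hg := Finset.sum_erase_add Finset.univ g (Finset.mem_univ i)
      have he : ∑ j ∈ Finset.univ.erase i, f j = ∑ j ∈ Finset.univ.erase i, g j :=
        Finset.sum_congr rfl fun j hj => hfg j (Finset.ne_of_mem_erase hj)
      linarith
    rw [hsplit _ _ fun j hj => by rw [plaquette_sliceFlip_none_of_ne i hzc U t y hj],
      re_trace_plaquette_sliceFlip_same ρ hL i hzc hz2 hρz U t y]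
    split_ifs <;> ring
  simp_rw [hel, Finset.sum_add_distrib]
  rw [Finset.sum_ite, Finset.sum_const_zero, add_zero]
  have hfilter : (Finset.univ.filter fun x : FiniteTemperature.Site d L₀ L => x.1 = 0 ∧ (x.2 i = 0 ∨ x.2 i = -1)) =
      fluxStack d L₀ L i ∪ adjFluxStack L₀ L i := by
    ext x; simp [fluxStack, adjFluxStack, and_or_left]
  have hdisj : Disjoint (fluxStack d L₀ L i) (adjFluxStack L₀ L i) := by
    rw [Finset.disjoint_left]
    rintro x hx hx'
    simp only [fluxStack, adjFluxStack, Finset.mem_filter, Finset.mem_univ, true_and] at hx hx'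
    have h0 : (0 : ZMod L) = -1 := hx.2.symm.trans hx'.2
    have h1 : (1 : ZMod L) = 0 := by
      have := congrArg Neg.neg h0
      simpa using this.symm
    exact one_ne_zero h1
  rw [hfilter, Finset.sum_union hdisj, ← Finset.mul_sum, ← Finset.mul_sum]
  ring

/-- `τ[S] = exp(−2 J_E Σ_{S} Re tr ρ(U_P))`. [cite: TomboulisYaffe1985, §II.A eq. (2.8) (p. 317)] -/
private theorem magneticFluxObs_eq_exp (JE : ℝ) (i : Fin d) (U : Config d L₀ L G) :
    magneticFluxObs ρ JE i U = Real.exp (-(2 * JE *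
      ∑ x ∈ fluxStack d L₀ L i, (ρ (FiniteTemperature.plaquette U x none (some i))).trace.re)) := by
  rw [magneticFluxObs, ← Real.exp_sum, Finset.mul_sum, ← Finset.sum_neg_distrib]

/-- `τ[S'] = exp(−2 J_E Σ_{S'} Re tr ρ(U_P))`. [cite: TomboulisYaffe1985, §II.A eq. (2.8) (p. 317)] -/
private theorem adjFluxObs_eq_exp (JE : ℝ) (i : Fin d) (U : Config d L₀ L G) :
    adjFluxObs ρ JE i U = Real.exp (-(2 * JE *
      ∑ x ∈ adjFluxStack L₀ L i, (ρ (FiniteTemperature.plaquette U x none (some i))).trace.re)) := by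
  rw [adjFluxObs, ← Real.exp_sum, Finset.mul_sum, ← Finset.sum_neg_distrib]

/-- **The weight under the flip**: `e^{−S(φU)} = e^{−S(U)} τ[S](U) τ[S'](U)` — inserting the flux
factors IS flipping the links. [cite: TomboulisYaffe1985, §III.A, text after eq. (3.2) (p. 321)] -/
theorem weight_sliceFlip (hL : 1 < L) (i : Fin d) {z : G} (hzc : ∀ g : G, g * z = z * g)
    (hz2 : z * z = 1) (hρz : ρ z = -1) (JE JM : ℝ) (U : Config d L₀ L G) :
    weight ρ JE JM (sliceFlip i z U) = weight ρ JE JM U * magneticFluxObs ρ JE i U * adjFluxObs ρ JE i U := by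
  rw [weight, weight, minusAction_sliceFlip ρ hL i hzc hz2 hρz, magneticFluxObs_eq_exp, adjFluxObs_eq_exp,
    ← Real.exp_add, ← Real.exp_add]
  congr 1; ring

/-- **The flux factor on the stack is inverted by the flip**: `τ[S](φU) τ[S](U) = 1`. [cite: TomboulisYaffe1985, §III.A, text after eq. (3.2) (p. 321)] -/
theorem magneticFluxObs_sliceFlip_mul (hL : 1 < L) (i : Fin d) {z : G} (hzc : ∀ g : G, g * z = z * g)
    (hz2 : z * z = 1) (hρz : ρ z = -1) (JE : ℝ) (U : Config d L₀ L G) :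
    magneticFluxObs ρ JE i (sliceFlip i z U) * magneticFluxObs ρ JE i U = 1 := by
  rw [magneticFluxObs, magneticFluxObs, ← Finset.prod_mul_distrib]
  refine Finset.prod_eq_one fun x hx => ?_
  rcases x with ⟨t, y⟩
  simp only [fluxStack, Finset.mem_filter, Finset.mem_univ, true_and] at hx
  rw [re_trace_plaquette_sliceFlip_same ρ hL i hzc hz2 hρz U t y, if_pos ⟨hx.1, Or.inl hx.2⟩,
    ← Real.exp_add]
  convert Real.exp_zero using 2; ring

/-- The same for the adjacent stack: `τ[S'](φU) τ[S'](U) = 1`. [cite: TomboulisYaffe1985, §III.A, text after eq. (3.2) (p. 321)] -/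
theorem adjFluxObs_sliceFlip_mul (hL : 1 < L) (i : Fin d) {z : G} (hzc : ∀ g : G, g * z = z * g)
    (hz2 : z * z = 1) (hρz : ρ z = -1) (JE : ℝ) (U : Config d L₀ L G) :
    adjFluxObs ρ JE i (sliceFlip i z U) * adjFluxObs ρ JE i U = 1 := by
  rw [adjFluxObs, adjFluxObs, ← Finset.prod_mul_distrib]
  refine Finset.prod_eq_one fun x hx => ?_
  rcases x with ⟨t, y⟩
  simp only [adjFluxStack, Finset.mem_filter, Finset.mem_univ, true_and] at hx
  rw [re_trace_plaquette_sliceFlip_same ρ hL i hzc hz2 hρz U t y, if_pos ⟨hx.1, Or.inr hx.2⟩,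
    ← Real.exp_add]
  convert Real.exp_zero using 2; ring

omit [NeZero L₀] [NeZero L] in
/-- Time-like holonomies at a spatial site read only the time-like links there. [folklore] -/
private theorem timeHolonomy_congr {U V : Config d L₀ L G} {y : Fin d → ZMod L}
    (h : ∀ t : ZMod L₀, U ((t, y), none) = V ((t, y), none)) :
    ∀ (m : ℕ) (t : ZMod L₀), timeHolonomy U m (t, y) = timeHolonomy V m (t, y) := by
  intro m
  induction m with
  | zero => intro t; rfl
  | succ m ih =>
      intro t
      simp only [timeHolonomy, FiniteTemperature.Site.shift]
      rw [h t, ih]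

omit [NeZero L₀] [NeZero L] in
/-- Hence so do Polyakov loops. [folklore] -/
private theorem polyakovLine_congr {U V : Config d L₀ L G} {y : Fin d → ZMod L}
    (h : ∀ t : ZMod L₀, U ((t, y), none) = V ((t, y), none)) : polyakovLine U y = polyakovLine V y :=
  timeHolonomy_congr h L₀ 0

omit [NeZero L₀] [NeZero L] in
/-- A time-like path from time `t ≥ 1` of length `m` with `t + m ≤ L₀` does not read the time-`0`
links. [folklore] -/
private theorem timeHolonomy_congr_of_ne_zero {U V : Config d L₀ L G} {y : Fin d → ZMod L}
    (h : ∀ t : ZMod L₀, t ≠ 0 → U ((t, y), none) = V ((t, y), none)) :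
    ∀ (m t : ℕ), 0 < t → t + m ≤ L₀ →
      timeHolonomy U m ((t : ZMod L₀), y) = timeHolonomy V m ((t : ZMod L₀), y) := by
  intro m
  induction m with
  | zero => intro t _ _; rfl
  | succ m ih =>
      intro t ht htm
      simp only [timeHolonomy, FiniteTemperature.Site.shift]
      have hne : (t : ZMod L₀) ≠ 0 := by
        intro h0
        rw [ZMod.natCast_eq_zero_iff] at h0
        exact absurd (Nat.le_of_dvd ht h0) (by omega)
      rw [h _ hne]
      have hcast : ((t : ZMod L₀) + 1) = ((t + 1 : ℕ) : ZMod L₀) := by push_cast; ring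
      rw [hcast, ih (t + 1) (by omega) (by omega)]

omit [NeZero L] in
/-- **Polyakov loops under the flip**: `Ω[y](φU) = z Ω[y](U)` if `y_i = 0`, else unchanged (the
loop at `y` reads the flipped link `((0,y), time)` exactly once). [cite: TomboulisYaffe1985, §III.A, text after eq. (3.2) (p. 321)] -/
theorem polyakovLine_sliceFlip (i : Fin d) (z : G) (U : Config d L₀ L G) (y : Fin d → ZMod L) :
    polyakovLine (sliceFlip i z U) y = (if y i = 0 then z else 1) * polyakovLine U y := by
  obtain ⟨m, hm⟩ : ∃ m, L₀ = m + 1 :=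
    ⟨L₀ - 1, (Nat.succ_pred_eq_of_pos (Nat.pos_of_ne_zero (NeZero.ne L₀))).symm⟩
  subst hm
  unfold polyakovLine
  simp only [timeHolonomy, FiniteTemperature.Site.shift, sliceFlip_none, flipFactor, true_and]
  have h1 : ((0 : ZMod (m + 1)) + 1) = ((1 : ℕ) : ZMod (m + 1)) := by simp
  rw [h1, timeHolonomy_congr_of_ne_zero (U := sliceFlip i z U) (V := U)
    (fun t ht => by rw [sliceFlip_none, flipFactor, if_neg (fun h => ht h.1), one_mul]) m 1 one_pos (by omega),
    mul_assoc]

end Flip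

/-! ### §7 Theorem II reduced to the disorder bounds: the reflection-positivity step (3.3) -/

section Vortex

variable {d L₀ n : ℕ}

/-- The central involution `−𝟙 ∈ SU(2)`. [folklore] -/
private def negId : SU2 :=
  ⟨-1, by
    rw [Matrix.mem_specialUnitaryGroup_iff]
    refine ⟨?_, ?_⟩
    · rw [Matrix.mem_unitaryGroup_iff]; simp
    · rw [Matrix.det_neg, Matrix.det_one, mul_one, Fintype.card_fin]; norm_num⟩

/-- `−𝟙` is central in `SU(2)`. [folklore] -/
private theorem negId_central (g : SU2) : g * negId = negId * g := by
  apply Subtype.ext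
  change (g : Matrix (Fin 2) (Fin 2) ℂ) * (-1) = (-1) * (g : Matrix (Fin 2) (Fin 2) ℂ)
  simp

/-- `−𝟙` is an involution. [folklore] -/
private theorem negId_mul_negId : negId * negId = 1 := by
  apply Subtype.ext
  change (-1 : Matrix (Fin 2) (Fin 2) ℂ) * (-1) = 1
  simp

/-- `ρ(−𝟙) = −𝟙` in the fundamental representation. [folklore] -/
private theorem fundamentalRep_negId : fundamentalRep (Fin 2) negId = -1 := rfl

/-- The half-trace under the flip: `½tr Ω[y](φU) = −½tr Ω[y](U)` on the plane `y_i = 0`, unchanged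
off it. [cite: TomboulisYaffe1985, §III.A, text after eq. (3.2) (p. 321)] -/
private theorem halfTrace_sliceFlip [NeZero L₀] {L : ℕ} (i : Fin d) (U : Config d L₀ L SU2) (y : Fin d → ZMod L) :
    halfTrace (sliceFlip i negId U) y = if y i = 0 then -halfTrace U y else halfTrace U y := by
  unfold halfTrace polyakovTrace
  rw [polyakovLine_sliceFlip]
  split_ifs with h
  · rw [map_mul, fundamentalRep_negId, neg_one_mul, Matrix.trace_neg, Complex.neg_re, neg_div]
  · rw [one_mul]

variable (n) in
/-- The site `x = ½L_s e_i` "halfway around the lattice" (`L_s = 2n + 2`). [cite: TomboulisYaffe1985, §III.A eq. (3.3) (p. 321)] -/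
def farSite (i : Fin d) : Fin d → ZMod (2 * n + 2) := Pi.single i ((n + 1 : ℕ) : ZMod (2 * n + 2))

/-- `siteRefl i 0 = 0`: the origin lies in the reflection plane. [folklore] -/
private theorem siteRefl_zero {L : ℕ} (i : Fin d) : siteRefl i (0 : Fin d → ZMod L) = 0 := by
  funext j; by_cases h : j = i
  · subst h; simp
  · simp [siteRefl_apply_of_ne h]

/-- `siteRefl i (½L e_i) = ½L e_i`: the far site lies in the second reflection plane. [folklore] -/
private theorem siteRefl_farSite (i : Fin d) : siteRefl i (farSite n i) = farSite n i := by
  funext j; by_cases h : j = i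
  · subst h; simp only [farSite, siteRefl_apply_same, Pi.single_eq_same]; exact neg_half n
  · simp [siteRefl_apply_of_ne h, farSite]

/-- The half-traces at `0` and at the far site are invariant under the site reflection `σ`. [folklore] -/
private theorem halfTrace_spaceSiteReflect_zero (i : Fin d) (U : Config d L₀ (2 * n + 2) SU2) :
    halfTrace (spaceSiteReflect i U) 0 = halfTrace U 0 := by
  unfold halfTrace; rw [polyakovTrace_spaceSiteReflect, siteRefl_zero]

/-- The half-trace at the far site is invariant under the site reflection `σ`. [folklore] -/
private theorem halfTrace_spaceSiteReflect_farSite (i : Fin d) (U : Config d L₀ (2 * n + 2) SU2) :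
    halfTrace (spaceSiteReflect i U) (farSite n i) = halfTrace U (farSite n i) := by
  unfold halfTrace; rw [polyakovTrace_spaceSiteReflect, siteRefl_farSite]

variable [NeZero L₀]

/-- The half-traces at `0` and at the far site are functions of the shared (in-plane) links. [folklore] -/
private theorem dependsOn_halfTraces (i : Fin d) (Φ : ℝ → ℝ → ℝ) :
    DependsOn (fun U : Config d L₀ (2 * n + 2) SU2 => Φ (halfTrace U 0) (halfTrace U (farSite n i)))
      ((sitePos d L₀ n i ∪ ∅ ∪ siteShared d L₀ n i : Finset _) : Set _) := by
  intro U V hUV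
  have h0 : halfTrace U 0 = halfTrace V 0 := by
    unfold halfTrace polyakovTrace
    rw [polyakovLine_congr (fun t => hUV _ (Finset.mem_coe.2 (by
      simp only [Finset.union_empty, Finset.mem_union]
      exact Or.inr (mem_siteShared_of (by simp) (Or.inl (by simp))))))]
  have hx : halfTrace U (farSite n i) = halfTrace V (farSite n i) := by
    unfold halfTrace polyakovTrace
    rw [polyakovLine_congr (fun t => hUV _ (Finset.mem_coe.2 (by
      simp only [Finset.union_empty, Finset.mem_union]
      exact Or.inr (mem_siteShared_of (by simp) (Or.inr (by simp [farSite]))))))]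
  simp only [h0, hx]

/-- **The adjacent flux factor is a positive-half observable**: `τ[S'_{0i}]` depends only on the links
based in the slice `−1`, plus the shared time-like links of the plane `y_i = 0`. [folklore] -/
private theorem dependsOn_adjFluxObs (hn : 1 ≤ n) (JE : ℝ) (i : Fin d) :
    DependsOn (adjFluxObs (fundamentalRep (Fin 2)) JE i : Config d L₀ (2 * n + 2) SU2 → ℝ)
      ((sitePos d L₀ n i ∪ ∅ ∪ siteShared d L₀ n i : Finset _) : Set _) := by
  haveI : Fact (1 < 2 * n + 2) := ⟨by omega⟩
  intro U V hUV
  unfold adjFluxObs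
  refine Finset.prod_congr rfl fun x hx => ?_
  rcases x with ⟨t, y⟩
  simp only [adjFluxStack, Finset.mem_filter, Finset.mem_univ, true_and] at hx
  obtain ⟨rfl, hy⟩ := hx
  have hval : (-y i).val = 1 := by rw [hy, neg_neg, ZMod.val_one]
  have hP : ∀ μ : Dir d, U (((0 : ZMod L₀), y), μ) = V ((0, y), μ) := fun μ =>
    hUV _ (Finset.mem_coe.2 (by
      simp only [Finset.union_empty, Finset.mem_union]
      exact Or.inl (mem_sitePos_of_val (by rw [hval]) (by rw [hval]; exact hn))))
  have hP1 : U (((0 : ZMod L₀) + 1, y), some i) = V ((0 + 1, y), some i) :=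
    hUV _ (Finset.mem_coe.2 (by
      simp only [Finset.union_empty, Finset.mem_union]
      exact Or.inl (mem_sitePos_of_val (by rw [hval]) (by rw [hval]; exact hn))))
  have hS : U (((0 : ZMod L₀), y + Pi.single i 1), none) = V ((0, y + Pi.single i 1), none) :=
    hUV _ (Finset.mem_coe.2 (by
      simp only [Finset.union_empty, Finset.mem_union]
      exact Or.inr (mem_siteShared_of (by simp) (Or.inl (by simp [hy])))))
  simp only [FiniteTemperature.plaquette, FiniteTemperature.Site.shift, hP, hP1, hS]

/-- **`τ[S'] ∘ σ = τ[S]`**: the site reflection in the planes `y_i = 0`, `y_i = ½L` maps the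
adjacent stack onto the stack (the `(time, i)` plaquette of `σU` at `(0, y)` is conjugate-inverse to
the one of `U` at `(0, σ(y + e_i))`, with the same real trace). [cite: TomboulisYaffe1985, §III.A eq. (3.3) (p. 321)] -/
private theorem adjFluxObs_spaceSiteReflect (JE : ℝ) (i : Fin d) (U : Config d L₀ (2 * n + 2) SU2) :
    adjFluxObs (fundamentalRep (Fin 2)) JE i (spaceSiteReflect i U) =
      magneticFluxObs (fundamentalRep (Fin 2)) JE i U := by
  unfold adjFluxObs magneticFluxObs
  -- the reindexing involution `(t, y) ↦ (t, σ(y + e_i))`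
  set r : FiniteTemperature.Site d L₀ (2 * n + 2) → FiniteTemperature.Site d L₀ (2 * n + 2) :=
    fun x => (x.1, siteRefl i (x.2 + Pi.single i 1)) with hr
  have hri : ∀ x, (r x).2 i = -(x.2 i) - 1 := fun x => by
    simp only [hr, siteRefl_apply_same, Pi.add_apply, Pi.single_eq_same, neg_add_rev]; ring
  have hrj : ∀ x (j : Fin d), j ≠ i → (r x).2 j = x.2 j := fun x j hj => by
    simp only [hr, siteRefl_apply_of_ne hj, Pi.add_apply, Pi.single_eq_of_ne hj, add_zero]
  have hrr : ∀ x, r (r x) = x := fun x => by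
    refine Prod.ext rfl (funext fun j => ?_)
    by_cases hj : j = i
    · subst hj; rw [hri, hri]; ring
    · rw [hrj _ _ hj, hrj _ _ hj]
  have htr : ∀ x : FiniteTemperature.Site d L₀ (2 * n + 2),
      ((fundamentalRep (Fin 2)) (FiniteTemperature.plaquette (spaceSiteReflect i U) x none (some i))).trace.re =
        ((fundamentalRep (Fin 2)) (FiniteTemperature.plaquette U (r x) none (some i))).trace.re := by
    rintro ⟨t, y⟩
    rw [spaceSiteReflect, plaquette_translate, siteShift_apply, plaquette_spaceReflect_none_same,
      trace_re_rep_conj, trace_re_rep_inv _ fundamentalRep_mem_unitaryGroup]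
  refine Finset.prod_nbij' r r (fun x hx => ?_) (fun x hx => ?_) (fun x _ => hrr x) (fun x _ => hrr x)
    (fun x _ => by rw [htr])
  · simp only [adjFluxStack, fluxStack, Finset.mem_filter, Finset.mem_univ, true_and] at hx ⊢
    exact ⟨hx.1, by rw [hri, hx.2]; ring⟩
  · simp only [adjFluxStack, fluxStack, Finset.mem_filter, Finset.mem_univ, true_and] at hx ⊢
    exact ⟨hx.1, by rw [hri, hx.2]; ring⟩

/-! #### Measure-theoretic plumbing for the flip and the reflection -/

/-- The flip by `−𝟙` as a measurable equivalence (an involution). [folklore] -/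
private def sliceFlipEquiv {L : ℕ} [NeZero L] (i : Fin d) : Config d L₀ L SU2 ≃ᵐ Config d L₀ L SU2 where
  toFun := sliceFlip i negId
  invFun := sliceFlip i negId
  left_inv := sliceFlip_sliceFlip i negId_mul_negId
  right_inv := sliceFlip_sliceFlip i negId_mul_negId
  measurable_toFun := (measurePreserving_sliceFlip i negId).measurable
  measurable_invFun := (measurePreserving_sliceFlip i negId).measurable

/-- **Change of variables by the flip**: `∫ f(φU) = ∫ f(U)`. [folklore] -/
private theorem integral_comp_sliceFlip {L : ℕ} [NeZero L] (i : Fin d) (f : Config d L₀ L SU2 → ℝ) :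
    ∫ U, f (sliceFlip i negId U) ∂haar d L₀ L SU2 = ∫ U, f U ∂haar d L₀ L SU2 := by
  have hmp : MeasurePreserving (sliceFlipEquiv (d := d) (L₀ := L₀) (L := L) i)
      (haar d L₀ L SU2) (haar d L₀ L SU2) := measurePreserving_sliceFlip i negId
  exact hmp.integral_comp' f

omit [NeZero L₀] in
/-- Continuity of the flux factors. [folklore] -/
private theorem continuous_fluxObs {L : ℕ} [NeZero L] (JE : ℝ) (i : Fin d)
    (T : Finset (FiniteTemperature.Site d L₀ L)) :
    Continuous fun U : Config d L₀ L SU2 => ∏ x ∈ T,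
      Real.exp (-(2 * JE * ((fundamentalRep (Fin 2)) (FiniteTemperature.plaquette U x none (some i))).trace.re)) :=
  continuous_finsetProd _ fun x _ => Real.continuous_exp.comp
    (continuous_const.mul (Complex.continuous_re.comp (Continuous.matrix_trace
      ((continuous_fundamentalRep (Fin 2)).comp (continuous_plaquette x _ _))))).neg

/-- Products against the reflected observable are integrable against the weight. [folklore] -/
private theorem integrable_mul_comp_mul_weight (JE JM : ℝ) (i : Fin d)
    {F G : Config d L₀ (2 * n + 2) SU2 → ℝ} (hFm : Measurable F) (hGm : Measurable G) {KF KG : ℝ}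
    (hFb : ∀ U, |F U| ≤ KF) (hGb : ∀ U, |G U| ≤ KG) :
    Integrable (fun U => F U * G (spaceSiteReflect i U) * weight (fundamentalRep (Fin 2)) JE JM U)
      (haar d L₀ (2 * n + 2) SU2) := by
  refine integrable_mul_weight (fundamentalRep (Fin 2)) (continuous_fundamentalRep (Fin 2)) JE JM
    ((hFm.mul (hGm.comp (continuous_spaceSiteReflect i).measurable)).aestronglyMeasurable)
    (C := KF * KG) fun U => ?_
  rw [abs_mul]
  exact mul_le_mul (hFb U) (hGb _) (abs_nonneg _) ((abs_nonneg _).trans (hFb U))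

/-- **Cauchy–Schwarz from reflection positivity** in the spatial lattice planes `y_i = 0`,
`y_i = ½L_s` (TY (2.4)–(2.5): "`|⟨FΘ(G)⟩| ≤ ⟨FΘ(F)⟩^{1/2}⟨GΘ(G)⟩^{1/2}` for any observables `F` and `G`
with supports in `Λ₊`"), in the symmetric form `⟨FΘG⟩ + ⟨GΘF⟩ ≤ 2⟨FΘF⟩^{1/2}⟨GΘG⟩^{1/2}` that the
positivity of the tree's `integral_mul_conj_spaceSiteReflect_mul_weight_nonneg` on `F + tG` yields
(discriminant). [cite: TomboulisYaffe1985, §II.A eqs. (2.4)–(2.5) (p. 315)] -/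
theorem rp_cauchy_schwarz (hn : 1 ≤ n) (JE JM : ℝ) (i : Fin d)
    {F G : Config d L₀ (2 * n + 2) SU2 → ℝ} (hFm : Measurable F) (hGm : Measurable G) {KF KG : ℝ}
    (hFb : ∀ U, |F U| ≤ KF) (hGb : ∀ U, |G U| ≤ KG)
    (hFd : DependsOn F ((sitePos d L₀ n i ∪ ∅ ∪ siteShared d L₀ n i : Finset _) : Set _))
    (hGd : DependsOn G ((sitePos d L₀ n i ∪ ∅ ∪ siteShared d L₀ n i : Finset _) : Set _)) :
    ∫ U, F U * G (spaceSiteReflect i U) * weight (fundamentalRep (Fin 2)) JE JM U ∂haar d L₀ (2 * n + 2) SU2 +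
      ∫ U, G U * F (spaceSiteReflect i U) * weight (fundamentalRep (Fin 2)) JE JM U ∂haar d L₀ (2 * n + 2) SU2 ≤
    2 * Real.sqrt (∫ U, F U * F (spaceSiteReflect i U) * weight (fundamentalRep (Fin 2)) JE JM U
        ∂haar d L₀ (2 * n + 2) SU2) *
      Real.sqrt (∫ U, G U * G (spaceSiteReflect i U) * weight (fundamentalRep (Fin 2)) JE JM U
        ∂haar d L₀ (2 * n + 2) SU2) := by
  set μ := haar d L₀ (2 * n + 2) SU2 with hμ
  set w : Config d L₀ (2 * n + 2) SU2 → ℝ := fun U => weight (fundamentalRep (Fin 2)) JE JM U with hw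
  set σ : Config d L₀ (2 * n + 2) SU2 → Config d L₀ (2 * n + 2) SU2 := spaceSiteReflect i with hσ
  set A : ℝ := ∫ U, F U * F (σ U) * w U ∂μ with hA
  set B : ℝ := ∫ U, F U * G (σ U) * w U ∂μ with hB
  set B' : ℝ := ∫ U, G U * F (σ U) * w U ∂μ with hB'
  set C : ℝ := ∫ U, G U * G (σ U) * w U ∂μ with hC
  -- reflection positivity of the real combinations `s F + t G`
  have hRP : ∀ s t : ℝ, 0 ≤ ∫ U, (s * F U + t * G U) * (s * F (σ U) + t * G (σ U)) * w U ∂μ := by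
    intro s t
    set O : Config d L₀ (2 * n + 2) SU2 → ℂ := fun U => ((s * F U + t * G U : ℝ) : ℂ) with hO
    have hOm : Measurable O :=
      Complex.measurable_ofReal.comp ((measurable_const.mul hFm).add (measurable_const.mul hGm))
    have hOb : ∀ U, ‖O U‖ ≤ |s| * KF + |t| * KG := fun U => by
      rw [hO, Complex.norm_real, Real.norm_eq_abs]
      calc |s * F U + t * G U| ≤ |s * F U| + |t * G U| := abs_add_le _ _
        _ = |s| * |F U| + |t| * |G U| := by rw [abs_mul, abs_mul]
        _ ≤ |s| * KF + |t| * KG := add_le_add (mul_le_mul_of_nonneg_left (hFb U) (abs_nonneg s))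
            (mul_le_mul_of_nonneg_left (hGb U) (abs_nonneg t))
    have hOd : DependsOn O ((sitePos d L₀ n i ∪ ∅ ∪ siteShared d L₀ n i : Finset _) : Set _) :=
      fun U V hUV => by simp only [hO, hFd hUV, hGd hUV]
    have h := integral_mul_conj_spaceSiteReflect_mul_weight_nonneg (fundamentalRep (Fin 2))
      fundamentalRep_mem_unitaryGroup (continuous_fundamentalRep (Fin 2)) hn JE JM i hOm hOb hOd
    have hint : (fun U => O U * conj (O (spaceSiteReflect i U)) * (weight (fundamentalRep (Fin 2)) JE JM U : ℂ)) =
        fun U => (((s * F U + t * G U) * (s * F (σ U) + t * G (σ U)) * w U : ℝ) : ℂ) := by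
      funext U; simp only [hO, hσ, hw, Complex.conj_ofReal]; push_cast; ring
    rw [hint, integral_complex_ofReal] at h
    exact Complex.zero_le_real.1 h
  -- integrability of the four products
  have hiFF := integrable_mul_comp_mul_weight (L₀ := L₀) JE JM i hFm hFm hFb hFb
  have hiFG := integrable_mul_comp_mul_weight (L₀ := L₀) JE JM i hFm hGm hFb hGb
  have hiGF := integrable_mul_comp_mul_weight (L₀ := L₀) JE JM i hGm hFm hGb hFb
  have hiGG := integrable_mul_comp_mul_weight (L₀ := L₀) JE JM i hGm hGm hGb hGb
  -- expansion of the quadratic form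
  have hexp : ∀ s t : ℝ, ∫ U, (s * F U + t * G U) * (s * F (σ U) + t * G (σ U)) * w U ∂μ =
      s * s * A + s * t * B + s * t * B' + t * t * C := by
    intro s t
    have hpt : (fun U => (s * F U + t * G U) * (s * F (σ U) + t * G (σ U)) * w U) =
        fun U => s * s * (F U * F (σ U) * w U) + s * t * (F U * G (σ U) * w U) +
          s * t * (G U * F (σ U) * w U) + t * t * (G U * G (σ U) * w U) := by
      funext U; ring
    rw [hpt, integral_add, integral_add, integral_add, integral_const_mul, integral_const_mul,
      integral_const_mul, integral_const_mul]
    · exact (hiFF.const_mul _)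
    · exact (hiFG.const_mul _)
    · exact (hiFF.const_mul _).add (hiFG.const_mul _)
    · exact (hiGF.const_mul _)
    · exact ((hiFF.const_mul _).add (hiFG.const_mul _)).add (hiGF.const_mul _)
    · exact (hiGG.const_mul _)
  have hA0 : 0 ≤ A := by have h := hRP 1 0; rw [hexp] at h; simpa using h
  have hC0 : 0 ≤ C := by have h := hRP 0 1; rw [hexp] at h; simpa using h
  have hpos : ∀ t : ℝ, 0 ≤ C * (t * t) + (B + B') * t + A := fun t => by
    have h := hRP 1 t
    rw [hexp] at h
    have e : C * (t * t) + (B + B') * t + A = 1 * 1 * A + 1 * t * B + 1 * t * B' + t * t * C := by ring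
    rw [e]; exact h
  have hdisc := discrim_le_zero hpos
  rw [discrim] at hdisc
  -- `(B + B')² ≤ 4 C A` ⇒ `B + B' ≤ 2 √A √C`
  have hsq : (B + B') ^ 2 ≤ (2 * Real.sqrt A * Real.sqrt C) ^ 2 := by
    rw [mul_pow, mul_pow, Real.sq_sqrt hA0, Real.sq_sqrt hC0]; nlinarith
  have hnn : 0 ≤ 2 * Real.sqrt A * Real.sqrt C := by positivity
  exact (abs_le_of_sq_le_sq' hsq hnn).2

/-- The `{0,1}`-valued observable `1{p(½tr Ω[0], ½tr Ω[x])}` of the two half-traces in the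
reflection planes (`x = ½L_s e_i`). [folklore] -/
private def hemObs (p : ℝ → ℝ → Prop) [DecidableRel p] (i : Fin d) (U : Config d L₀ (2 * n + 2) SU2) : ℝ :=
  if p (halfTrace U 0) (halfTrace U (farSite n i)) then 1 else 0

/-- **One reflection-positivity step of (3.3)**: for a `{0,1}`-valued observable `q` of the two
half-traces `½tr Ω[0]`, `½tr Ω[x]` (`x = ½L_s e_i`; both sites lie in the reflection planes),
`∫ q τ[S'] e^{−S} + ∫ q τ[S] e^{−S} ≤ 2 √Z √(∫ q e^{−S})`: Cauchy–Schwarz with `F = q τ[S']`, `G = q`,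
then "the next step repeats the change of variables used above", turning `⟨q τ[S]τ[S']⟩` into
`⟨q ∘ φ⟩ ≤ 1`. [cite: TomboulisYaffe1985, §III.A eq. (3.3) and the text after it (pp. 321–322)] -/
private theorem vortex_rp_step (hn : 1 ≤ n) (JE JM : ℝ) (i : Fin d) (p : ℝ → ℝ → Prop) [DecidableRel p]
    (hE : MeasurableSet {U : Config d L₀ (2 * n + 2) SU2 | p (halfTrace U 0) (halfTrace U (farSite n i))}) :
    ∫ U, hemObs p i U * adjFluxObs (fundamentalRep (Fin 2)) JE i U * weight (fundamentalRep (Fin 2)) JE JM U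
        ∂haar d L₀ (2 * n + 2) SU2 +
      ∫ U, hemObs p i U * magneticFluxObs (fundamentalRep (Fin 2)) JE i U * weight (fundamentalRep (Fin 2)) JE JM U
        ∂haar d L₀ (2 * n + 2) SU2 ≤
    2 * Real.sqrt (∫ U, weight (fundamentalRep (Fin 2)) JE JM U ∂haar d L₀ (2 * n + 2) SU2) *
      Real.sqrt (∫ U, hemObs p i U * weight (fundamentalRep (Fin 2)) JE JM U ∂haar d L₀ (2 * n + 2) SU2) := by
  haveI : Fact (1 < 2 * n + 2) := ⟨by omega⟩
  have hL1 : 1 < 2 * n + 2 := by omega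
  have hρc := continuous_fundamentalRep (Fin 2)
  -- properties of `q = hemObs p i`
  have hqm : Measurable (hemObs (L₀ := L₀) (n := n) p i) := Measurable.ite hE measurable_const measurable_const
  have hq01 : ∀ U : Config d L₀ (2 * n + 2) SU2, 0 ≤ hemObs p i U ∧ hemObs p i U ≤ 1 := fun U => by
    unfold hemObs; split_ifs <;> simp
  have hqq : ∀ U : Config d L₀ (2 * n + 2) SU2, hemObs p i U * hemObs p i U = hemObs p i U := fun U => by
    unfold hemObs; split_ifs <;> simp
  have hqb : ∀ U : Config d L₀ (2 * n + 2) SU2, |hemObs p i U| ≤ 1 := fun U => by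
    rw [abs_of_nonneg (hq01 U).1]; exact (hq01 U).2
  have hqσ : ∀ U : Config d L₀ (2 * n + 2) SU2, hemObs p i (spaceSiteReflect i U) = hemObs p i U := fun U => by
    simp only [hemObs, halfTrace_spaceSiteReflect_zero, halfTrace_spaceSiteReflect_farSite]
  have hqd : DependsOn (hemObs (L₀ := L₀) (n := n) p i)
      ((sitePos d L₀ n i ∪ ∅ ∪ siteShared d L₀ n i : Finset _) : Set _) :=
    dependsOn_halfTraces i fun x y => if p x y then (1 : ℝ) else 0
  -- properties of the flux factors
  have hτ'c : Continuous fun U : Config d L₀ (2 * n + 2) SU2 => adjFluxObs (fundamentalRep (Fin 2)) JE i U :=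
    continuous_fluxObs JE i _
  obtain ⟨Kτ', hKτ'⟩ : ∃ K : ℝ, ∀ U : Config d L₀ (2 * n + 2) SU2, |adjFluxObs (fundamentalRep (Fin 2)) JE i U| ≤ K := by
    obtain ⟨K, hK⟩ := isCompact_univ.exists_bound_of_continuousOn hτ'c.continuousOn
    exact ⟨K, fun U => by simpa [Real.norm_eq_abs] using hK U (Set.mem_univ U)⟩
  -- Cauchy–Schwarz with `F = q τ'`, `G = q`
  have hFm : Measurable fun U : Config d L₀ (2 * n + 2) SU2 =>
      hemObs p i U * adjFluxObs (fundamentalRep (Fin 2)) JE i U := hqm.mul hτ'c.measurable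
  have hFb : ∀ U : Config d L₀ (2 * n + 2) SU2,
      |hemObs p i U * adjFluxObs (fundamentalRep (Fin 2)) JE i U| ≤ 1 * Kτ' := fun U => by
    rw [abs_mul]; exact mul_le_mul (hqb U) (hKτ' U) (abs_nonneg _) zero_le_one
  have hFd : DependsOn (fun U : Config d L₀ (2 * n + 2) SU2 =>
      hemObs p i U * adjFluxObs (fundamentalRep (Fin 2)) JE i U)
      ((sitePos d L₀ n i ∪ ∅ ∪ siteShared d L₀ n i : Finset _) : Set _) :=
    fun U V hUV => by simp only [hqd hUV, dependsOn_adjFluxObs (L₀ := L₀) hn JE i hUV]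
  have hCS := rp_cauchy_schwarz (L₀ := L₀) hn JE JM i hFm hqm hFb hqb hFd hqd
  beta_reduce at hCS
  -- identify the four integrands
  have e1 : (fun U : Config d L₀ (2 * n + 2) SU2 => hemObs p i U * adjFluxObs (fundamentalRep (Fin 2)) JE i U *
      hemObs p i (spaceSiteReflect i U) * weight (fundamentalRep (Fin 2)) JE JM U) =
      fun U => hemObs p i U * adjFluxObs (fundamentalRep (Fin 2)) JE i U * weight (fundamentalRep (Fin 2)) JE JM U := by
    funext U; rw [hqσ, mul_right_comm (hemObs p i U), hqq]
  have e2 : (fun U : Config d L₀ (2 * n + 2) SU2 => hemObs p i U *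
      (hemObs p i (spaceSiteReflect i U) * adjFluxObs (fundamentalRep (Fin 2)) JE i (spaceSiteReflect i U)) *
        weight (fundamentalRep (Fin 2)) JE JM U) =
      fun U => hemObs p i U * magneticFluxObs (fundamentalRep (Fin 2)) JE i U * weight (fundamentalRep (Fin 2)) JE JM U := by
    funext U; rw [hqσ, adjFluxObs_spaceSiteReflect, ← mul_assoc, hqq]
  have e3 : (fun U : Config d L₀ (2 * n + 2) SU2 => hemObs p i U * adjFluxObs (fundamentalRep (Fin 2)) JE i U *
      (hemObs p i (spaceSiteReflect i U) * adjFluxObs (fundamentalRep (Fin 2)) JE i (spaceSiteReflect i U)) *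
        weight (fundamentalRep (Fin 2)) JE JM U) =
      fun U => hemObs p i U * magneticFluxObs (fundamentalRep (Fin 2)) JE i U *
        adjFluxObs (fundamentalRep (Fin 2)) JE i U * weight (fundamentalRep (Fin 2)) JE JM U := by
    funext U; rw [hqσ, adjFluxObs_spaceSiteReflect]
    calc hemObs p i U * adjFluxObs (fundamentalRep (Fin 2)) JE i U *
          (hemObs p i U * magneticFluxObs (fundamentalRep (Fin 2)) JE i U) * weight (fundamentalRep (Fin 2)) JE JM U
        = (hemObs p i U * hemObs p i U) * magneticFluxObs (fundamentalRep (Fin 2)) JE i U *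
            adjFluxObs (fundamentalRep (Fin 2)) JE i U * weight (fundamentalRep (Fin 2)) JE JM U := by ring
      _ = _ := by rw [hqq]
  have e4 : (fun U : Config d L₀ (2 * n + 2) SU2 => hemObs p i U * hemObs p i (spaceSiteReflect i U) *
      weight (fundamentalRep (Fin 2)) JE JM U) =
      fun U => hemObs p i U * weight (fundamentalRep (Fin 2)) JE JM U := by
    funext U; rw [hqσ, hqq]
  rw [e1, e2, e3, e4] at hCS
  -- the flip: `∫ q τ τ' e^{−S} = ∫ (q ∘ φ) e^{−S} ≤ Z`
  have hflip : ∫ U, hemObs p i U * magneticFluxObs (fundamentalRep (Fin 2)) JE i U *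
      adjFluxObs (fundamentalRep (Fin 2)) JE i U * weight (fundamentalRep (Fin 2)) JE JM U ∂haar d L₀ (2 * n + 2) SU2 ≤
      ∫ U, weight (fundamentalRep (Fin 2)) JE JM U ∂haar d L₀ (2 * n + 2) SU2 := by
    rw [← integral_comp_sliceFlip i (fun U => hemObs p i U * magneticFluxObs (fundamentalRep (Fin 2)) JE i U *
      adjFluxObs (fundamentalRep (Fin 2)) JE i U * weight (fundamentalRep (Fin 2)) JE JM U)]
    have key : ∀ V : Config d L₀ (2 * n + 2) SU2,
        hemObs p i (sliceFlip i negId V) * magneticFluxObs (fundamentalRep (Fin 2)) JE i (sliceFlip i negId V) *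
          adjFluxObs (fundamentalRep (Fin 2)) JE i (sliceFlip i negId V) *
            weight (fundamentalRep (Fin 2)) JE JM (sliceFlip i negId V) =
        hemObs p i (sliceFlip i negId V) * weight (fundamentalRep (Fin 2)) JE JM V := by
      intro V
      rw [weight_sliceFlip (fundamentalRep (Fin 2)) hL1 i negId_central negId_mul_negId fundamentalRep_negId]
      have h1 := magneticFluxObs_sliceFlip_mul (fundamentalRep (Fin 2)) hL1 i negId_central negId_mul_negId
        fundamentalRep_negId JE V
      have h2 := adjFluxObs_sliceFlip_mul (fundamentalRep (Fin 2)) hL1 i negId_central negId_mul_negId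
        fundamentalRep_negId JE V
      calc hemObs p i (sliceFlip i negId V) * magneticFluxObs (fundamentalRep (Fin 2)) JE i (sliceFlip i negId V) *
            adjFluxObs (fundamentalRep (Fin 2)) JE i (sliceFlip i negId V) *
            (weight (fundamentalRep (Fin 2)) JE JM V * magneticFluxObs (fundamentalRep (Fin 2)) JE i V *
              adjFluxObs (fundamentalRep (Fin 2)) JE i V)
          = hemObs p i (sliceFlip i negId V) * weight (fundamentalRep (Fin 2)) JE JM V *
              (magneticFluxObs (fundamentalRep (Fin 2)) JE i (sliceFlip i negId V) *
                magneticFluxObs (fundamentalRep (Fin 2)) JE i V) *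
              (adjFluxObs (fundamentalRep (Fin 2)) JE i (sliceFlip i negId V) *
                adjFluxObs (fundamentalRep (Fin 2)) JE i V) := by ring
        _ = _ := by rw [h1, h2, mul_one, mul_one]
    simp_rw [key]
    refine integral_mono ?_ (integrable_of_continuous (continuous_weight (fundamentalRep (Fin 2)) hρc JE JM))
      fun V => ?_
    · exact integrable_mul_weight (fundamentalRep (Fin 2)) hρc JE JM
        ((hqm.comp (measurePreserving_sliceFlip i negId).measurable).aestronglyMeasurable) (C := 1)
        fun V => hqb _
    · have hw := (weight_pos (d := d) (L₀ := L₀) (L := 2 * n + 2) (fundamentalRep (Fin 2)) JE JM V).le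
      calc hemObs p i (sliceFlip i negId V) * weight (fundamentalRep (Fin 2)) JE JM V
          ≤ 1 * weight (fundamentalRep (Fin 2)) JE JM V := mul_le_mul_of_nonneg_right (hq01 _).2 hw
        _ = _ := one_mul _
  -- conclude
  have hZ0 : 0 ≤ ∫ U, weight (fundamentalRep (Fin 2)) JE JM U ∂haar d L₀ (2 * n + 2) SU2 :=
    (partitionFunction_pos (fundamentalRep (Fin 2)) hρc JE JM).le
  refine hCS.trans ?_
  have hsq := Real.sqrt_le_sqrt hflip
  have hq0 : 0 ≤ Real.sqrt (∫ U, hemObs p i U * weight (fundamentalRep (Fin 2)) JE JM U ∂haar d L₀ (2 * n + 2) SU2) :=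
    Real.sqrt_nonneg _
  nlinarith [Real.sqrt_nonneg (∫ U, weight (fundamentalRep (Fin 2)) JE JM U ∂haar d L₀ (2 * n + 2) SU2)]

/-- The five-way partition of unity by the signs of two reals. [folklore] -/
private theorem five_partition (x y : ℝ) :
    (if 0 < x ∧ 0 < y then (1 : ℝ) else 0) + (if x < 0 ∧ y < 0 then (1 : ℝ) else 0) +
      (if x < 0 ∧ 0 < y then (1 : ℝ) else 0) + (if 0 < x ∧ y < 0 then (1 : ℝ) else 0) +
        (if x = 0 ∨ y = 0 then (1 : ℝ) else 0) = 1 := by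
  rcases lt_trichotomy x 0 with hx | hx | hx
  · rcases lt_trichotomy y 0 with hy | hy | hy
    · simp [hx, hy, lt_asymm hx, lt_asymm hy, hx.ne, hy.ne]
    · simp [hx, hy, lt_asymm hx, hx.ne]
    · simp [hx, hy, lt_asymm hx, lt_asymm hy, hx.ne, hy.ne']
  · rcases lt_trichotomy y 0 with hy | hy | hy
    · simp [hx, hy, lt_asymm hy, hy.ne]
    · simp [hx, hy]
    · simp [hx, hy, lt_asymm hy, hy.ne']
  · rcases lt_trichotomy y 0 with hy | hy | hy
    · simp [hx, hy, lt_asymm hx, lt_asymm hy, hx.ne', hy.ne]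
    · simp [hx, hy, lt_asymm hx, hx.ne']
    · simp [hx, hy, lt_asymm hx, lt_asymm hy, hx.ne', hy.ne']

/-- Strictly opposite signs are a domain wall. [folklore] -/
private theorem ite_opposite_le_wall (x y : ℝ) :
    (if x < 0 ∧ 0 < y then (1 : ℝ) else 0) + (if 0 < x ∧ y < 0 then (1 : ℝ) else 0) ≤
      (if ¬ (0 ≤ x ↔ 0 ≤ y) then (1 : ℝ) else 0) := by
  by_cases h1 : x < 0 ∧ 0 < y
  · have : ¬ (0 ≤ x ↔ 0 ≤ y) := fun h => absurd (h.2 h1.2.le) (not_le.2 h1.1)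
    rw [if_pos h1, if_neg (fun h2 => lt_asymm h1.1 h2.1), if_pos this, add_zero]
  · by_cases h2 : 0 < x ∧ y < 0
    · have : ¬ (0 ≤ x ↔ 0 ≤ y) := fun h => absurd (h.1 h2.1.le) (not_le.2 h2.2)
      rw [if_neg h1, if_pos h2, if_pos this, zero_add]
    · rw [if_neg h1, if_neg h2, add_zero]; split_ifs <;> norm_num

/-- A vanishing half-trace is a point defect: `1{x = 0 ∨ y = 0} ≤ (1 - |x|) + (1 - |y|)` on `[-1,1]²`. [folklore] -/
private theorem ite_zero_le_defects {x y : ℝ} (hx : |x| ≤ 1) (hy : |y| ≤ 1) :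
    (if x = 0 ∨ y = 0 then (1 : ℝ) else 0) ≤ (1 - |x|) + (1 - |y|) := by
  split_ifs with h
  · rcases h with h | h
    · rw [h, abs_zero]; linarith
    · rw [h, abs_zero]; linarith
  · linarith

/-- `(½L e_i)_i ≠ 0`: the far site is off the flipped plane. [folklore] -/
private theorem farSite_apply_ne_zero (i : Fin d) : farSite n i i ≠ 0 := by
  intro h
  have := congrArg ZMod.val h
  rw [farSite, Pi.single_eq_same, val_natCast_half, ZMod.val_zero] at this
  omega

/-- ★ **TY's (3.3) combined with the Peierls estimate, in one periodic box** (`SU(2)`, `d ≥ 2`,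
`L_s = 2n + 2 ≥ 4`, any temporal extent and couplings): under the disorder bounds (3.25)–(3.26) at
rate `K` (`ρ = 4·19⁶K < 1`), the vortex (magnetic-flux) expectation obeys
`exp(−F^{mag}_{0i}/T) = Z⁻/Z ≤ 4 √(d·4ρ/(1-ρ)²) + 2 √(2K)`.  Printed route: insert the hemisphere
projections at `0` and `x = ½L_s e_i`, flip the time-like links `{l₀(n) | n₀ = n_i = 0}` (moving the
stack `S_{0i}` to `S'_{0i}` and `P₀^± ↦ P₀^∓`), apply reflection positivity in the lattice planes
`⊥ e_i` through `0` and `x`, and flip again (`⟨P τ[S]τ[S']⟩ = ⟨P ∘ φ⟩ ≤ 1`); here with the five-way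
partition `{±,0} × {±,0}` of the two signs (the defect term `1{½trΩ = 0} ≤ 1 - |½trΩ|` is absorbed by
(3.25)), so that no boundary convention for `P^±` is needed. [cite: TomboulisYaffe1985, §III.A eq. (3.3) (pp. 321–322); §III Theorem II (p. 320)] -/
theorem magneticFluxExp_le_of_disorderBounds (hd : 2 ≤ d) (hn : 1 ≤ n) {L : ℕ} [NeZero L]
    (hL : L = 2 * n + 2) {JE JM K : ℝ} (hK : 0 ≤ K) (hρ : 4 * 19 ^ 6 * K < 1)
    (hpt : expectation (fundamentalRep (Fin 2)) JE JM
      (fun U : Config d L₀ L SU2 => 1 - |halfTrace U 0|) ≤ K)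
    (hB : ∀ B : Finset ((Fin d → ZMod L) × Fin d),
      expectation (fundamentalRep (Fin 2)) JE JM
        ((wallEvent (d := d) (L₀ := L₀) (L := L) B).indicator 1) ≤ K ^ B.card)
    (i : Fin d) :
    magneticFluxExp (d := d) (L₀ := L₀) (L := L) (fundamentalRep (Fin 2)) JE JM i ≤
      4 * Real.sqrt (d * (4 * (4 * 19 ^ 6 * K) / (1 - 4 * 19 ^ 6 * K) ^ 2)) + 2 * Real.sqrt (2 * K) := by
  subst hL
  haveI : Fact (1 < 2 * n + 2) := ⟨by omega⟩
  have hL1 : 1 < 2 * n + 2 := by omega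
  have hL2 : 2 < 2 * n + 2 := by omega
  have hρc := continuous_fundamentalRep (Fin 2)
  have hZ := partitionFunction_pos (d := d) (L₀ := L₀) (L := 2 * n + 2) (fundamentalRep (Fin 2)) hρc JE JM
  set P : ℝ := d * (4 * (4 * 19 ^ 6 * K) / (1 - 4 * 19 ^ 6 * K) ^ 2) with hP
  -- measurability of the sign events
  have hma : Measurable fun U : Config d L₀ (2 * n + 2) SU2 => halfTrace U 0 := (continuous_halfTrace 0).measurable
  have hmb : Measurable fun U : Config d L₀ (2 * n + 2) SU2 => halfTrace U (farSite n i) :=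
    (continuous_halfTrace _).measurable
  have hEpp : MeasurableSet {U : Config d L₀ (2 * n + 2) SU2 | 0 < halfTrace U 0 ∧ 0 < halfTrace U (farSite n i)} :=
    (measurableSet_lt measurable_const hma).inter (measurableSet_lt measurable_const hmb)
  have hEmm : MeasurableSet {U : Config d L₀ (2 * n + 2) SU2 | halfTrace U 0 < 0 ∧ halfTrace U (farSite n i) < 0} :=
    (measurableSet_lt hma measurable_const).inter (measurableSet_lt hmb measurable_const)
  have hE1 : MeasurableSet {U : Config d L₀ (2 * n + 2) SU2 | halfTrace U 0 < 0 ∧ 0 < halfTrace U (farSite n i)} :=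
    (measurableSet_lt hma measurable_const).inter (measurableSet_lt measurable_const hmb)
  have hE2 : MeasurableSet {U : Config d L₀ (2 * n + 2) SU2 | 0 < halfTrace U 0 ∧ halfTrace U (farSite n i) < 0} :=
    (measurableSet_lt measurable_const hma).inter (measurableSet_lt hmb measurable_const)
  have hER : MeasurableSet {U : Config d L₀ (2 * n + 2) SU2 | halfTrace U 0 = 0 ∨ halfTrace U (farSite n i) = 0} :=
    (measurableSet_eq_fun hma measurable_const).union (measurableSet_eq_fun hmb measurable_const)
  -- the flux factors: continuity, bounds
  have hτc : Continuous fun U : Config d L₀ (2 * n + 2) SU2 => magneticFluxObs (fundamentalRep (Fin 2)) JE i U :=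
    continuous_fluxObs JE i _
  have hτ'c : Continuous fun U : Config d L₀ (2 * n + 2) SU2 => adjFluxObs (fundamentalRep (Fin 2)) JE i U :=
    continuous_fluxObs JE i _
  obtain ⟨Kτ, hKτ⟩ : ∃ K : ℝ, ∀ U : Config d L₀ (2 * n + 2) SU2, |magneticFluxObs (fundamentalRep (Fin 2)) JE i U| ≤ K := by
    obtain ⟨K, hK⟩ := isCompact_univ.exists_bound_of_continuousOn hτc.continuousOn
    exact ⟨K, fun U => by simpa [Real.norm_eq_abs] using hK U (Set.mem_univ U)⟩
  obtain ⟨Kτ', hKτ'⟩ : ∃ K : ℝ, ∀ U : Config d L₀ (2 * n + 2) SU2, |adjFluxObs (fundamentalRep (Fin 2)) JE i U| ≤ K := by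
    obtain ⟨K, hK⟩ := isCompact_univ.exists_bound_of_continuousOn hτ'c.continuousOn
    exact ⟨K, fun U => by simpa [Real.norm_eq_abs] using hK U (Set.mem_univ U)⟩
  -- integrability of `q τ w`, `q τ' w` for measurable `{0,1}`-valued `q`
  have hint : ∀ (p : ℝ → ℝ → Prop) [DecidableRel p],
      MeasurableSet {U : Config d L₀ (2 * n + 2) SU2 | p (halfTrace U 0) (halfTrace U (farSite n i))} →
      Integrable (fun U => hemObs p i U * magneticFluxObs (fundamentalRep (Fin 2)) JE i U *
        weight (fundamentalRep (Fin 2)) JE JM U) (haar d L₀ (2 * n + 2) SU2) ∧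
      Integrable (fun U => hemObs p i U * adjFluxObs (fundamentalRep (Fin 2)) JE i U *
        weight (fundamentalRep (Fin 2)) JE JM U) (haar d L₀ (2 * n + 2) SU2) := by
    intro p _ hE
    have hqm : Measurable (hemObs (L₀ := L₀) (n := n) p i) := Measurable.ite hE measurable_const measurable_const
    have hqb : ∀ U : Config d L₀ (2 * n + 2) SU2, |hemObs p i U| ≤ 1 := fun U => by
      unfold hemObs; split_ifs <;> simp
    refine ⟨integrable_mul_weight (fundamentalRep (Fin 2)) hρc JE JM (hqm.mul hτc.measurable).aestronglyMeasurable
        (C := 1 * Kτ) fun U => ?_,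
      integrable_mul_weight (fundamentalRep (Fin 2)) hρc JE JM (hqm.mul hτ'c.measurable).aestronglyMeasurable
        (C := 1 * Kτ') fun U => ?_⟩
    · rw [abs_mul]; exact mul_le_mul (hqb U) (hKτ U) (abs_nonneg _) zero_le_one
    · rw [abs_mul]; exact mul_le_mul (hqb U) (hKτ' U) (abs_nonneg _) zero_le_one
  obtain ⟨hIpp, -⟩ := hint (fun x y => 0 < x ∧ 0 < y) hEpp
  obtain ⟨hImm, -⟩ := hint (fun x y => x < 0 ∧ y < 0) hEmm
  obtain ⟨hI1, hI1'⟩ := hint (fun x y => x < 0 ∧ 0 < y) hE1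
  obtain ⟨hI2, hI2'⟩ := hint (fun x y => 0 < x ∧ y < 0) hE2
  obtain ⟨hIR, hIR'⟩ := hint (fun x y => x = 0 ∨ y = 0) hER
  -- Step 1: the partition of `∫ τ e^{−S}`
  have hsplit : ∫ U, magneticFluxObs (fundamentalRep (Fin 2)) JE i U * weight (fundamentalRep (Fin 2)) JE JM U
      ∂haar d L₀ (2 * n + 2) SU2 =
      ∫ U, hemObs (fun x y => 0 < x ∧ 0 < y) i U * magneticFluxObs (fundamentalRep (Fin 2)) JE i U *
          weight (fundamentalRep (Fin 2)) JE JM U ∂haar d L₀ (2 * n + 2) SU2 +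
      ∫ U, hemObs (fun x y => x < 0 ∧ y < 0) i U * magneticFluxObs (fundamentalRep (Fin 2)) JE i U *
          weight (fundamentalRep (Fin 2)) JE JM U ∂haar d L₀ (2 * n + 2) SU2 +
      ∫ U, hemObs (fun x y => x < 0 ∧ 0 < y) i U * magneticFluxObs (fundamentalRep (Fin 2)) JE i U *
          weight (fundamentalRep (Fin 2)) JE JM U ∂haar d L₀ (2 * n + 2) SU2 +
      ∫ U, hemObs (fun x y => 0 < x ∧ y < 0) i U * magneticFluxObs (fundamentalRep (Fin 2)) JE i U *
          weight (fundamentalRep (Fin 2)) JE JM U ∂haar d L₀ (2 * n + 2) SU2 +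
      ∫ U, hemObs (fun x y => x = 0 ∨ y = 0) i U * magneticFluxObs (fundamentalRep (Fin 2)) JE i U *
          weight (fundamentalRep (Fin 2)) JE JM U ∂haar d L₀ (2 * n + 2) SU2 := by
    have hS2 : Integrable (fun U => hemObs (fun x y => 0 < x ∧ 0 < y) i U * magneticFluxObs (fundamentalRep (Fin 2)) JE i U *
          weight (fundamentalRep (Fin 2)) JE JM U +
        hemObs (fun x y => x < 0 ∧ y < 0) i U * magneticFluxObs (fundamentalRep (Fin 2)) JE i U *
          weight (fundamentalRep (Fin 2)) JE JM U) (haar d L₀ (2 * n + 2) SU2) := hIpp.add hImm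
    have hS3 : Integrable (fun U => hemObs (fun x y => 0 < x ∧ 0 < y) i U * magneticFluxObs (fundamentalRep (Fin 2)) JE i U *
          weight (fundamentalRep (Fin 2)) JE JM U +
        hemObs (fun x y => x < 0 ∧ y < 0) i U * magneticFluxObs (fundamentalRep (Fin 2)) JE i U *
          weight (fundamentalRep (Fin 2)) JE JM U +
        hemObs (fun x y => x < 0 ∧ 0 < y) i U * magneticFluxObs (fundamentalRep (Fin 2)) JE i U *
          weight (fundamentalRep (Fin 2)) JE JM U) (haar d L₀ (2 * n + 2) SU2) := hS2.add hI1
    have hS4 : Integrable (fun U => hemObs (fun x y => 0 < x ∧ 0 < y) i U * magneticFluxObs (fundamentalRep (Fin 2)) JE i U *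
          weight (fundamentalRep (Fin 2)) JE JM U +
        hemObs (fun x y => x < 0 ∧ y < 0) i U * magneticFluxObs (fundamentalRep (Fin 2)) JE i U *
          weight (fundamentalRep (Fin 2)) JE JM U +
        hemObs (fun x y => x < 0 ∧ 0 < y) i U * magneticFluxObs (fundamentalRep (Fin 2)) JE i U *
          weight (fundamentalRep (Fin 2)) JE JM U +
        hemObs (fun x y => 0 < x ∧ y < 0) i U * magneticFluxObs (fundamentalRep (Fin 2)) JE i U *
          weight (fundamentalRep (Fin 2)) JE JM U) (haar d L₀ (2 * n + 2) SU2) := hS3.add hI2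
    rw [← integral_add hIpp hImm, ← integral_add hS2 hI1, ← integral_add hS3 hI2, ← integral_add hS4 hIR]
    refine integral_congr_ae (Eventually.of_forall fun U => ?_)
    have h := five_partition (halfTrace U 0) (halfTrace U (farSite n i))
    simp only [hemObs]
    calc magneticFluxObs (fundamentalRep (Fin 2)) JE i U * weight (fundamentalRep (Fin 2)) JE JM U
        = ((if 0 < halfTrace U 0 ∧ 0 < halfTrace U (farSite n i) then (1 : ℝ) else 0) +
            (if halfTrace U 0 < 0 ∧ halfTrace U (farSite n i) < 0 then (1 : ℝ) else 0) +
            (if halfTrace U 0 < 0 ∧ 0 < halfTrace U (farSite n i) then (1 : ℝ) else 0) +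
            (if 0 < halfTrace U 0 ∧ halfTrace U (farSite n i) < 0 then (1 : ℝ) else 0) +
            (if halfTrace U 0 = 0 ∨ halfTrace U (farSite n i) = 0 then (1 : ℝ) else 0)) *
            (magneticFluxObs (fundamentalRep (Fin 2)) JE i U * weight (fundamentalRep (Fin 2)) JE JM U) := by
          rw [h, one_mul]
      _ = _ := by ring
  -- Step 2: the two flips `⟨Q₊₊ τ[S]⟩ = ⟨Q₋₊ τ[S']⟩`, `⟨Q₋₋ τ[S]⟩ = ⟨Q₊₋ τ[S']⟩`
  have hflipId : ∀ (p p' : ℝ → ℝ → Prop) [DecidableRel p] [DecidableRel p'],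
      (∀ x y, p (-x) y ↔ p' x y) →
      ∫ U, hemObs p i U * magneticFluxObs (fundamentalRep (Fin 2)) JE i U *
          weight (fundamentalRep (Fin 2)) JE JM U ∂haar d L₀ (2 * n + 2) SU2 =
      ∫ U, hemObs p' i U * adjFluxObs (fundamentalRep (Fin 2)) JE i U *
          weight (fundamentalRep (Fin 2)) JE JM U ∂haar d L₀ (2 * n + 2) SU2 := by
    intro p p' _ _ hpp'
    rw [← integral_comp_sliceFlip i (fun U => hemObs p i U * magneticFluxObs (fundamentalRep (Fin 2)) JE i U *
      weight (fundamentalRep (Fin 2)) JE JM U)]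
    refine integral_congr_ae (Eventually.of_forall fun V => ?_)
    have hq : hemObs p i (sliceFlip i negId V) = hemObs p' i V := by
      simp only [hemObs, halfTrace_sliceFlip, Pi.zero_apply, if_true, farSite_apply_ne_zero, if_false, hpp']
    dsimp only
    rw [hq, weight_sliceFlip (fundamentalRep (Fin 2)) hL1 i negId_central negId_mul_negId fundamentalRep_negId]
    have h1 := magneticFluxObs_sliceFlip_mul (fundamentalRep (Fin 2)) hL1 i negId_central negId_mul_negId
      fundamentalRep_negId JE V
    calc hemObs p' i V * magneticFluxObs (fundamentalRep (Fin 2)) JE i (sliceFlip i negId V) *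
          (weight (fundamentalRep (Fin 2)) JE JM V * magneticFluxObs (fundamentalRep (Fin 2)) JE i V *
            adjFluxObs (fundamentalRep (Fin 2)) JE i V)
        = hemObs p' i V * adjFluxObs (fundamentalRep (Fin 2)) JE i V * weight (fundamentalRep (Fin 2)) JE JM V *
            (magneticFluxObs (fundamentalRep (Fin 2)) JE i (sliceFlip i negId V) *
              magneticFluxObs (fundamentalRep (Fin 2)) JE i V) := by ring
      _ = _ := by rw [h1, mul_one]
  have hf1 := hflipId (fun x y => 0 < x ∧ 0 < y) (fun x y => x < 0 ∧ 0 < y) (fun x y => by simp)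
  have hf2 := hflipId (fun x y => x < 0 ∧ y < 0) (fun x y => 0 < x ∧ y < 0) (fun x y => by simp)
  -- Step 3: the three reflection-positivity steps
  have hcs1 := vortex_rp_step (L₀ := L₀) hn JE JM i (fun x y => x < 0 ∧ 0 < y) hE1
  have hcs2 := vortex_rp_step (L₀ := L₀) hn JE JM i (fun x y => 0 < x ∧ y < 0) hE2
  have hcsR := vortex_rp_step (L₀ := L₀) hn JE JM i (fun x y => x = 0 ∨ y = 0) hER
  have hRτ'0 : 0 ≤ ∫ U, hemObs (fun x y => x = 0 ∨ y = 0) i U * adjFluxObs (fundamentalRep (Fin 2)) JE i U *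
      weight (fundamentalRep (Fin 2)) JE JM U ∂haar d L₀ (2 * n + 2) SU2 :=
    integral_nonneg fun U => mul_nonneg (mul_nonneg (by unfold hemObs; split_ifs <;> norm_num)
      (Finset.prod_nonneg fun _ _ => (Real.exp_pos _).le)) (weight_pos _ JE JM U).le
  -- Step 4: the three probabilities
  set Z : ℝ := ∫ U, weight (fundamentalRep (Fin 2)) JE JM U ∂haar d L₀ (2 * n + 2) SU2 with hZdef
  have hexpect : ∀ (p : ℝ → ℝ → Prop) [DecidableRel p],
      ∫ U, hemObs p i U * weight (fundamentalRep (Fin 2)) JE JM U ∂haar d L₀ (2 * n + 2) SU2 =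
        Z * expectation (fundamentalRep (Fin 2)) JE JM (hemObs (L₀ := L₀) (n := n) p i) := by
    intro p _
    unfold expectation
    rw [hZdef, mul_div_cancel₀ _ hZ.ne']
  have hwall := expectation_wall_le (L₀ := L₀) hd hL2 (JE := JE) (JM := JM) hK hρ hB (farSite n i)
  -- integrability of `q e^{−S}` for the three events
  have hIw : ∀ (p : ℝ → ℝ → Prop) [DecidableRel p],
      MeasurableSet {U : Config d L₀ (2 * n + 2) SU2 | p (halfTrace U 0) (halfTrace U (farSite n i))} →
      Integrable (fun U => hemObs p i U * weight (fundamentalRep (Fin 2)) JE JM U) (haar d L₀ (2 * n + 2) SU2) := by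
    intro p _ hE
    have hqm : Measurable (hemObs (L₀ := L₀) (n := n) p i) := Measurable.ite hE measurable_const measurable_const
    exact integrable_mul_weight (fundamentalRep (Fin 2)) hρc JE JM hqm.aestronglyMeasurable (C := 1)
      fun U => by unfold hemObs; split_ifs <;> simp
  have hIw1 := hIw (fun x y => x < 0 ∧ 0 < y) hE1
  have hIw2 := hIw (fun x y => 0 < x ∧ y < 0) hE2
  have hIwR := hIw (fun x y => x = 0 ∨ y = 0) hER
  have hq12 : expectation (fundamentalRep (Fin 2)) JE JM (hemObs (L₀ := L₀) (n := n) (fun x y => x < 0 ∧ 0 < y) i) +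
      expectation (fundamentalRep (Fin 2)) JE JM (hemObs (L₀ := L₀) (n := n) (fun x y => 0 < x ∧ y < 0) i) ≤ P := by
    rw [← expectation_add' (fundamentalRep (Fin 2)) JE JM hIw1 hIw2]
    refine le_trans ?_ hwall
    have hI12 : Integrable (fun U => (hemObs (fun x y => x < 0 ∧ 0 < y) i U + hemObs (fun x y => 0 < x ∧ y < 0) i U) *
        weight (fundamentalRep (Fin 2)) JE JM U) (haar d L₀ (2 * n + 2) SU2) := by
      simp_rw [add_mul]; exact hIw1.add hIw2
    refine expectation_mono_of_integrable (fundamentalRep (Fin 2)) hρc JE JM hI12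
      (integrable_indicator_mul_weight JE JM (measurableSet_wall _ _)) fun U => ?_
    have h := ite_opposite_le_wall (halfTrace U 0) (halfTrace U (farSite n i))
    simp only [hemObs, Set.indicator_apply, Set.mem_setOf_eq, Pi.one_apply]
    exact h
  have hqR : expectation (fundamentalRep (Fin 2)) JE JM (hemObs (L₀ := L₀) (n := n) (fun x y => x = 0 ∨ y = 0) i) ≤ 2 * K := by
    have hia : Integrable (fun U : Config d L₀ (2 * n + 2) SU2 => (1 - |halfTrace U 0|) *
        weight (fundamentalRep (Fin 2)) JE JM U) (haar d L₀ (2 * n + 2) SU2) :=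
      integrable_mul_weight (fundamentalRep (Fin 2)) hρc JE JM
        (continuous_const.sub (continuous_halfTrace 0).abs).aestronglyMeasurable (C := 1) fun U => by
          have h1 := abs_halfTrace_le_one U 0
          have h0 := abs_nonneg (halfTrace U 0)
          rw [abs_le]; constructor <;> linarith
    have hib : Integrable (fun U : Config d L₀ (2 * n + 2) SU2 => (1 - |halfTrace U (farSite n i)|) *
        weight (fundamentalRep (Fin 2)) JE JM U) (haar d L₀ (2 * n + 2) SU2) :=
      integrable_mul_weight (fundamentalRep (Fin 2)) hρc JE JM
        (continuous_const.sub (continuous_halfTrace _).abs).aestronglyMeasurable (C := 1) fun U => by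
          have h1 := abs_halfTrace_le_one U (farSite n i)
          have h0 := abs_nonneg (halfTrace U (farSite n i))
          rw [abs_le]; constructor <;> linarith
    calc expectation (fundamentalRep (Fin 2)) JE JM (hemObs (L₀ := L₀) (n := n) (fun x y => x = 0 ∨ y = 0) i)
        ≤ expectation (fundamentalRep (Fin 2)) JE JM (fun U : Config d L₀ (2 * n + 2) SU2 =>
            (1 - |halfTrace U 0|) + (1 - |halfTrace U (farSite n i)|)) := by
          refine expectation_mono_of_integrable (fundamentalRep (Fin 2)) hρc JE JM hIwR ?_ fun U => ?_
          · simp_rw [add_mul]; exact hia.add hib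
          · exact ite_zero_le_defects (abs_halfTrace_le_one U 0) (abs_halfTrace_le_one U _)
      _ = expectation (fundamentalRep (Fin 2)) JE JM (fun U : Config d L₀ (2 * n + 2) SU2 => 1 - |halfTrace U 0|) +
          expectation (fundamentalRep (Fin 2)) JE JM (fun U : Config d L₀ (2 * n + 2) SU2 =>
            1 - |halfTrace U (farSite n i)|) := expectation_add' (fundamentalRep (Fin 2)) JE JM hia hib
      _ ≤ K + K := add_le_add hpt (by rw [expectation_pointDefect_translate]; exact hpt)
      _ = 2 * K := by ring
  -- Step 5: assemble
  have hP0 : 0 ≤ P := by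
    rw [hP]
    have : 0 ≤ 1 - 4 * 19 ^ 6 * K := by linarith
    positivity
  have hE0 : ∀ (p : ℝ → ℝ → Prop) [DecidableRel p],
      0 ≤ expectation (fundamentalRep (Fin 2)) JE JM (hemObs (L₀ := L₀) (n := n) p i) := by
    intro p _
    unfold expectation
    exact div_nonneg (integral_nonneg fun U => mul_nonneg (by unfold hemObs; split_ifs <;> norm_num)
      (weight_pos _ JE JM U).le) hZ.le
  -- `√(∫ q w) ≤ √Z √bound`
  have hsq : ∀ (p : ℝ → ℝ → Prop) [DecidableRel p] (b : ℝ),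
      expectation (fundamentalRep (Fin 2)) JE JM (hemObs (L₀ := L₀) (n := n) p i) ≤ b →
      Real.sqrt (∫ U, hemObs p i U * weight (fundamentalRep (Fin 2)) JE JM U ∂haar d L₀ (2 * n + 2) SU2) ≤
        Real.sqrt Z * Real.sqrt b := by
    intro p _ b hb
    rw [hexpect, ← Real.sqrt_mul hZ.le]
    exact Real.sqrt_le_sqrt (mul_le_mul_of_nonneg_left hb hZ.le)
  have hs1 := hsq (fun x y => x < 0 ∧ 0 < y) P (by linarith [hE0 (fun x y => 0 < x ∧ y < 0)])
  have hs2 := hsq (fun x y => 0 < x ∧ y < 0) P (by linarith [hE0 (fun x y => x < 0 ∧ 0 < y)])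
  have hsR := hsq (fun x y => x = 0 ∨ y = 0) (2 * K) hqR
  -- the bound on `∫ τ e^{−S}`
  have hT : ∫ U, magneticFluxObs (fundamentalRep (Fin 2)) JE i U * weight (fundamentalRep (Fin 2)) JE JM U
      ∂haar d L₀ (2 * n + 2) SU2 ≤ 2 * Real.sqrt Z * (2 * (Real.sqrt Z * Real.sqrt P) + Real.sqrt Z * Real.sqrt (2 * K)) := by
    rw [hsplit, hf1, hf2]
    have hZs : 0 ≤ Real.sqrt Z := Real.sqrt_nonneg _
    nlinarith [hcs1, hcs2, hcsR, hRτ'0, hs1, hs2, hsR, mul_nonneg (mul_nonneg zero_le_two hZs) (Real.sqrt_nonneg P)]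
  unfold magneticFluxExp expectation
  rw [div_le_iff₀ hZ]
  have hZZ : Real.sqrt Z * Real.sqrt Z = Z := Real.mul_self_sqrt hZ.le
  calc ∫ U, magneticFluxObs (fundamentalRep (Fin 2)) JE i U * weight (fundamentalRep (Fin 2)) JE JM U
        ∂haar d L₀ (2 * n + 2) SU2
      ≤ 2 * Real.sqrt Z * (2 * (Real.sqrt Z * Real.sqrt P) + Real.sqrt Z * Real.sqrt (2 * K)) := hT
    _ = (4 * Real.sqrt P + 2 * Real.sqrt (2 * K)) * (Real.sqrt Z * Real.sqrt Z) := by ring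
    _ = (4 * Real.sqrt P + 2 * Real.sqrt (2 * K)) * Z := by rw [hZZ]
    _ = _ := by rw [hZdef]

/-- The point-defect observable `1 - |½tr Ω[0]|` has nonnegative expectation (so any bound
`⟨1 - |½trΩ[0]|⟩ ≤ K` forces `K ≥ 0`). [folklore] -/
private theorem expectation_pointDefect_nonneg {L : ℕ} [NeZero L] (JE JM : ℝ) :
    0 ≤ expectation (fundamentalRep (Fin 2)) JE JM (fun U : Config d L₀ L SU2 => 1 - |halfTrace U 0|) := by
  have hρc := continuous_fundamentalRep (Fin 2)
  have hZ := partitionFunction_pos (d := d) (L₀ := L₀) (L := L) (fundamentalRep (Fin 2)) hρc JE JM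
  rw [← expectation_const (d := d) (L₀ := L₀) (L := L) (fundamentalRep (Fin 2)) hZ 0]
  refine expectation_mono_of_integrable (fundamentalRep (Fin 2)) hρc _ _ ?_ ?_ fun U => ?_
  · simp_rw [zero_mul]; exact integrable_zero _ _ _
  · exact integrable_mul_weight (fundamentalRep (Fin 2)) hρc _ _
      (continuous_const.sub (continuous_halfTrace 0).abs).aestronglyMeasurable (C := 1) fun U => by
        have h1 := abs_halfTrace_le_one U 0
        have h0 := abs_nonneg (halfTrace U 0)
        rw [abs_le]; constructor <;> linarith
  · have h1 := abs_halfTrace_le_one U 0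
    linarith

/-- ★★ **Tomboulis–Yaffe's Theorem II from their disorder bounds (3.25)–(3.26)** — the content of
§III.A eq. (3.3) (the two changes of variables flipping the time-like links `{l₀(n) | n₀ = n₁ = 0}`,
reflection positivity in the spatial lattice planes through `0` and `x = ½L_s e₁`) together with the
Peierls bound (3.8), PROVED: under the same hypotheses as `polyakovTwoPointLowerBound_of_disorderBounds`,
`MagneticFluxFreeEnergyBound` holds, with `ε = ¼` above the threshold:
`exp(−F^{mag}_{01}/T) ≤ 4√(d·4ρ/(1-ρ)²) + 2√(2K(θ)) ≤ ½ = 1 − 2ε` once `K(θ)` is small, uniformly in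
`L_s = 2^k ≥ 4`. Theorem II itself (i.e. the disorder bounds of §III.C) is NOT proved here.
[cite: TomboulisYaffe1985, §III Theorem II (p. 320) and its equivalent form (p. 321); §III.A eq. (3.3) (pp. 321–322); §III.B eq. (3.8) (p. 323); §III.C eqs. (3.25)–(3.26) (p. 325)] -/
theorem magneticFluxFreeEnergyBound_of_disorderBounds
    (h : ∀ γ : ℝ, 0 < γ → ∀ d : ℕ, 2 ≤ d → ∀ a : ℕ,
      ∃ θ₀ : ℝ, ∃ K : ℝ → ℝ, Tendsto K atTop (𝓝 0) ∧
        ∀ θ : ℝ, θ₀ < θ → ∀ k : ℕ, 2 ≤ k →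
          expectation (d := d) (L₀ := 2 ^ a) (L := 2 ^ k) (fundamentalRep (Fin 2)) (γ * θ) (γ / θ)
              (fun U => 1 - |halfTrace U 0|) ≤ K θ ∧
          ∀ B : Finset ((Fin d → ZMod (2 ^ k)) × Fin d),
            expectation (d := d) (L₀ := 2 ^ a) (L := 2 ^ k) (fundamentalRep (Fin 2)) (γ * θ) (γ / θ)
              ((wallEvent B).indicator 1) ≤ K θ ^ B.card) :
    MagneticFluxFreeEnergyBound := by
  intro γ hγ d hd a
  obtain ⟨θ₀, K, hK, hθ⟩ := h γ hγ d hd a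
  -- smallness threshold
  set δ : ℝ := min (1 / (256 * (64 * 19 ^ 6 * d))) (1 / 128) with hδ
  have hd0 : (0 : ℝ) < d := by exact_mod_cast (show 0 < d by omega)
  have hδpos : 0 < δ := by rw [hδ]; positivity
  obtain ⟨θ₁, hθ₁⟩ := eventually_atTop.1 (hK.eventually (gt_mem_nhds hδpos))
  refine ⟨max θ₀ θ₁, fun θ hθθ => ⟨1 / 4, by norm_num, fun k hk => ?_⟩⟩
  have hθ0 : θ₀ < θ := lt_of_le_of_lt (le_max_left _ _) hθθ
  have hθ1 : θ₁ ≤ θ := (le_max_right _ _).trans hθθ.le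
  obtain ⟨hpt, hB⟩ := hθ θ hθ0 k hk
  have hKδ : K θ < δ := hθ₁ θ hθ1
  have hK0 : 0 ≤ K θ := (expectation_pointDefect_nonneg _ _).trans hpt
  have hK1 : K θ ≤ 1 / (256 * (64 * 19 ^ 6 * d)) := hKδ.le.trans (min_le_left _ _)
  have hK2 : K θ ≤ 1 / 128 := hKδ.le.trans (min_le_right _ _)
  -- `ρ ≤ 1/2`
  have hρhalf : 4 * 19 ^ 6 * K θ ≤ 1 / 2 := by
    have h1 : 4 * 19 ^ 6 * K θ ≤ 4 * 19 ^ 6 * (1 / (256 * (64 * 19 ^ 6 * d))) :=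
      mul_le_mul_of_nonneg_left hK1 (by positivity)
    have h2 : (4 : ℝ) * 19 ^ 6 * (1 / (256 * (64 * 19 ^ 6 * d))) = 1 / (4096 * d) := by
      field_simp; ring
    have hd2 : (2 : ℝ) ≤ d := by exact_mod_cast hd
    have h3 : (1 : ℝ) / (4096 * d) ≤ 1 / 2 :=
      one_div_le_one_div_of_le (by norm_num) (by linarith)
    linarith
  have hρ1 : 4 * 19 ^ 6 * K θ < 1 := by linarith
  -- the box `L = 2^k = 2n + 2`
  obtain ⟨m, rfl⟩ : ∃ m, k = m + 2 := ⟨k - 2, by omega⟩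
  have hp : 2 ^ (m + 2) = 2 * 2 ^ (m + 1) := by rw [pow_succ]; ring
  have h2 : 2 ≤ 2 ^ (m + 1) := by
    calc 2 = 2 ^ 1 := (pow_one 2).symm
      _ ≤ 2 ^ (m + 1) := Nat.pow_le_pow_right (by norm_num) (by omega)
  have hbox := magneticFluxExp_le_of_disorderBounds (L₀ := 2 ^ a) (n := 2 ^ (m + 1) - 1) hd (by omega)
    (L := 2 ^ (m + 2)) (by omega) hK0 hρ1 hpt hB ⟨0, by omega⟩
  refine hbox.trans ?_
  -- `4 √P + 2 √(2K) ≤ 1/2`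
  have hgeom := geom_bound_le (by positivity : (0:ℝ) ≤ 4 * 19 ^ 6 * K θ) hρhalf
  have hP : (d : ℝ) * (4 * (4 * 19 ^ 6 * K θ) / (1 - 4 * 19 ^ 6 * K θ) ^ 2) ≤ (1 / 16) ^ 2 := by
    calc (d : ℝ) * (4 * (4 * 19 ^ 6 * K θ) / (1 - 4 * 19 ^ 6 * K θ) ^ 2)
        ≤ d * (16 * (4 * 19 ^ 6 * K θ)) := mul_le_mul_of_nonneg_left hgeom hd0.le
      _ = (64 * 19 ^ 6 * d) * K θ := by ring
      _ ≤ (64 * 19 ^ 6 * d) * (1 / (256 * (64 * 19 ^ 6 * d))) := mul_le_mul_of_nonneg_left hK1 (by positivity)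
      _ = (1 / 16) ^ 2 := by field_simp; ring
  have h1 : Real.sqrt ((d : ℝ) * (4 * (4 * 19 ^ 6 * K θ) / (1 - 4 * 19 ^ 6 * K θ) ^ 2)) ≤ 1 / 16 :=
    Real.sqrt_le_iff.2 ⟨by norm_num, hP⟩
  have h2 : Real.sqrt (2 * K θ) ≤ 1 / 8 :=
    Real.sqrt_le_iff.2 ⟨by norm_num, by nlinarith⟩
  linarith

end Vortex











end TomboulisYaffeHighTemperature

end Literature.MathematicalPhysics.QuantumFieldTheory
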